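import Summits.QuantumFields.YangMills.Theorems.BalabanUVNodesN15CurvedGluingSmoothCutDressedGluedAdjointTrueDefect
import Summits.QuantumFields.YangMills.Theorems.BalabanUVNodesN15CurvedGluingSmoothCutDressedGluedAdjointGaugedDefect
import HarnessLib

/-!
# THE TWO-SPACING η-DEFECT OF ENTRY 2 `𝒢∘∇⁻_ν` FOR ANY RIGHT INVERSES `Y`, `Y′` OF THE GLOBAL OPERATORS AT TWO GRIDS — FILE 158 ★★★ fed by the dressed smooth-cut cubes' rows and η-defects at
# both grids (file 34 ∕ 35 by letter, FILE 153 ★, FILE 148 §3, FILE 156 ★★★, FILE 167 ★) with the TRUE right-locality defects displayed, and the identification FILE 167 ★★ at both grids: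
# `𝔇_π(Y′∘∇′⁻_ν, Y∘∇⁻_ν)` decays at the η-rate — the operands LITERALLY the node's `cvGlued′∘∇′⁻_ν`, `cvGlued∘∇⁻_ν` once instantiated (dag-n15-c g19, FILE 169; N15 = NE2, s1 road (c))

Cell `pub-ymgap`, seat `pub-ymgap-dag-n15-c` (R134 (a); HUMAN RULING D-0062), generation 19.  `bears_on: R4∕N15 · K3⁸ SpineGivenEndpointR13SepCoPHV (stmt-QuantumFields-27366)`.
Filed `--kind proof --supports stmt-QuantumFields-27366 --as helper` — COUNT-NEUTRAL.  Theorems only; 0 `def`, 0 `sorry`.  Imports BY NAME FILE 167 `…GluedAdjointTrueDefect` (★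
`hasMaj_smoothCutDressed_comp_commOp_global`, ★★ `glued_adjoint_eq_rightInverse`; through it FILE 158 `hasMaj_idef_glueInvL_parametrix_comp_cut_of_defect_out`, FILE 153), FILE 163
`…GluedAdjointGauged` (`mulOp_fst_comp_bgrad_leib`), FILE 156 `…CubeSmoothCutDressedAdjointRowSandwichDefect` (★★★ `hasMaj_idef_smoothCutDressed_comp_commOp_cubeOp_out_of_sandwich`; through it FILE 148 §3
`hasMaj_idef_neumannR_comp_loc₂`, file 31 `hasMaj_mulOp_comp_loc₂'` ∕ `hasMaj_idef_mulOp_comp_loc₂`, FILE 165 `adjCapstoneTwoGrid_letters_nonneg`).  Nothing in the tree is modified; nothing restated.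
ONE declared `set_option maxHeartbeats 800000 in` (the assembly passes ≈ 250 displayed rows to FILES 153 ∕ 156 ∕ 158 at both grids, as FILE 165 did).

WHY.  NE2 is an η-RATE ([B9] Thm 3.14): the node's entry 2 is `𝔇_π̂(cvGlued′∘∇′^{U*}, cvGlued∘∇^{U*})`.  FILE 168 is the one-grid entry for any right inverse; THIS FILE is its two-grid twin —
FILE 165's architecture (per cube at both grids: cut rows, sandwiched adjoint right entries with their η-defect by FILE 148 §3, adjoint remainder rows and their η-defect by FILE 156 ★★★ plus the
far rows) WITHOUT gauges (global gauge, `W = 0`), with the TRUE right-locality defects `Ẽ_k`, `Ẽ′_k` displayed by rows and η-defect, glued by FILE 158 ★★★, and both adjoint glued operators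
identified with the right inverses `Y`, `Y′` (FILE 167 ★★) — so the conclusion names ONLY `𝔇_π(Y′∘∇′⁻_ν, Y∘∇⁻_ν)`.  FILE 159 then appends the transport of `∇^{U*}_μ` in the plain currency.

WHAT.  ★★★ `hasMaj_idef_rightInverse_bgrad_smoothCutDressed`: FILE 165's displayed data minus every gauge row (cube data, sandwiches and their defects, `𝒲`-letters and defect, the cut rows'
defect by letter `m^X`, partition letters ∕ fits ∕ transition layers at both grids, species rows and fits, nonlocal commutator letters and defects, base rows and defects, overlap), plus: the
splits `Δ = model_k + F_k`, `Δ′ = model′_k + F′_k` with far commutator rows `θ_F` and their defect `r_{FK}`, the TRUE right-locality defects (`ε_F`, `r_{FE}`), `Σ_kh_k² = 1` at both grids,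
`Δ∘Y = 1`, `Δ′∘Y′ = 1`, ONE smallness `N_ov(Θ′ + ε_F)c_r < 1` ⟹ `𝔇_π(Y′∘∇′⁻_ν, Y∘∇⁻_ν) ≤ [(1−q)⁻¹m̂c_r + (1−q)⁻¹(r̂((1−q)⁻¹Âc_r)c_r)c_r]·e^{−(ρ₃−2σ)d}` (FILE 158 ★★★'s letters:
`q = N_ov(Θ′ + ε_F)c_r`, `Â = N_ov(β^X + B̄′c₁)`, `r̂ = N_ov((Θ_D + r_{FK}) + oΘ′ + (r_{FE} + oε_F))`, `m̂ = N_ov[(β^Xo_s + (m^{TX} + o^c_χβ^X) + oβ^X) + (B̄′o₁ + m^Xc₁ + oB̄′c₁)]`).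

HONEST FRAMING ∕ LIMITS.  Composition of LANDED theorems over DISPLAYED rows at both grids — the η-rate content of entry 2 of (3.42) in the global small-field gauge as a CONDITIONAL statement on
King's ∕ dag-n15-a's model carriers; proves NO estimate of a concrete propagator; nothing of [B5]∕[B6]∕[B9] asserted ((2.91)–(2.93) p.239, (2.133)–(2.136) p.247, (3.42) p.397, (3.62)–(3.65)
pp.402–403, (3.87) p.409 = SHAPES; Thm 3.14 pp.426–427 = difference TEMPLATE).  NE2 for non-abelian `G(U)` NOT proved (C-N15-1); N15 booked «discharged AS CONSUMED at the U-blind v7 pin»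
(№253) — road (c)'s bookkeeping, NO count; K3⁸ skeleton untouched; one finite 𝕋⁴ at fixed ε — NOT infinite volume, NOT OS on ℝ⁴, NOT a mass gap, NOT Clay.  Restate-immune (no Theses import).
-/

set_option autoImplicit false

noncomputable section
open scoped BigOperators Matrix
open Finset

namespace Summit.QuantumFields.YangMills.BalabanUVNodes.N15.Gluing

open Literature.MathematicalPhysics.QuantumFieldTheory.Balaban1983to89
open Literature.MathematicalPhysics.QuantumFieldTheory.Balaban1983to89.B11SectG (BlockNorm HasMaj RowSum hasMaj_zero)
open Literature.MathematicalPhysics.QuantumFieldTheory.Balaban1983to89.B6RandomWalk (Triangle254)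
open Literature.MathematicalPhysics.QuantumFieldTheory.Balaban1983to89.T4EtaRateDefect (idef idef_comp idef_add idef_zero)
open Literature.MathematicalPhysics.QuantumFieldTheory.Balaban1983to89.T4EtaRateCoeffDefect (pull diagK diagK_nonneg hasMaj_mulOp)
open Literature.MathematicalPhysics.QuantumFieldTheory.Balaban1983to89.B6Prop26Gluing (mulOp mulOp_apply ind ind_nonneg ind_le_one)
open Summit.QuantumFields.YangMills.BalabanUVNodes.N15.MatrixSpecies (mmulOp liftBlk liftMap liftEquiv liftEquiv_apply liftEquiv_symm_apply)
open Summit.QuantumFields.YangMills.BalabanUVNodes.N15.BackgroundLayer (fgrad bgrad fgradAdj fgrad_apply bgrad_apply stack projO unstackM bgPropV blkPair fgradMat)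
open Summit.QuantumFields.YangMills.BalabanUVNodes.N15.CurvedSpecies (hasMaj_smoothCutDressed_loc₂ mulOp_comp_smoothCutDressed hasMaj_smoothCut_flat hasMaj_jet_smoothCut_flat smoothCut_out
  hasMaj_dressedV_pair hasMaj_mulOp_comp_loc₂' hasMaj_idef_mulOp_comp_loc₂)

variable {X X' ι J K : Type} [Fintype X] [Fintype X'] [DecidableEq X] [DecidableEq X'] [Fintype ι] [DecidableEq ι] [Fintype J] [DecidableEq J] [Fintype K] {g : B6.Geometry}
  (blk : X → g.Site) (π : X' → X) (τ : J → X ≃ X) (τ' : J → X' ≃ X') (n n' : ℝ) (ν : J)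
  {σ cr : ℝ} {N : K → (X × ι → ℝ) →ₗ[ℝ] (X × ι → ℝ)} {N' : K → (X' × ι → ℝ) →ₗ[ℝ] (X' × ι → ℝ)} {C : K → X → Matrix ι ι ℝ} {C' : K → X' → Matrix ι ι ℝ}
  {A : K → J ⊕ J → X → Matrix ι ι ℝ} {A' : K → J ⊕ J → X' → Matrix ι ι ℝ} {NV : K → (X × ι → ℝ) →ₗ[ℝ] (X × ι → ℝ)} {NV' : K → (X' × ι → ℝ) →ₗ[ℝ] (X' × ι → ℝ)}
  {Δ NL Yop : (X × ι → ℝ) →ₗ[ℝ] (X × ι → ℝ)} {Δ' NL' Yop' : (X' × ι → ℝ) →ₗ[ℝ] (X' × ι → ℝ)} {F Ed : K → (X × ι → ℝ) →ₗ[ℝ] (X × ι → ℝ)} {F' Ed' : K → (X' × ι → ℝ) →ₗ[ℝ] (X' × ι → ℝ)}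
  {χX χtX ψX ψ₂X hX : K → X → ℝ} {χX' χtX' ψX' ψ₂X' hX' : K → X' → ℝ} {Sk : K → Set g.Site} {hb : K → g.Site → ℝ}
  {Tf Tb : K → J → (X × ι → ℝ) →ₗ[ℝ] (X × ι → ℝ)} {Tf' Tb' : K → J → (X' × ι → ℝ) →ₗ[ℝ] (X' × ι → ℝ)}

set_option maxHeartbeats 800000 in
/-- ★★★ **THE TWO-SPACING η-DEFECT OF ENTRY 2 `Y∘∇⁻_ν` FOR ANY RIGHT INVERSES OF THE GLOBAL OPERATORS AT TWO GRIDS, FROM THE DRESSED SMOOTH-CUT CUBES GLUED ADJOINTLY WITH THEIR TRUE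
RIGHT-LOCALITY DEFECTS** (global gauge at both grids, `W = 0`) — FILE 158 ★★★ with, per cube at both grids: the cut rows (file 34) and their η-defect by letter (`M_χX = X`), the sandwiched adjoint
right entries through the `ν`-shifted partition functions (FILE 153) with rows (FILE 153 ★) and η-defect (FILE 148 §3, cut by `χ` with its fit), the adjoint remainder rows against the GLOBAL
operators (FILE 167 ★) and their η-defect (FILE 156 ★★★ + the far defect), the true right-locality defects' rows and η-defect (displayed), the scalar adjoint Leibniz rules; then FILE 167 ★★ at both
grids rewrites both adjoint glued operators into the right inverses `Y`, `Y′`.  Letters as in FILE 158 ★★★ with `β := B̄′`, `β₂ := β^X`, `c_s := 1`, `c_d := c₁`, `o_d := o₁`, `m₀ := m^X`,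
`m₂ := 1·m^{TX} + o^c_χβ^X`, `θ₀ := Θ′ = Θ₁₅₃ + θ_F`, `ε := ε_F`, `r := Θ_D + r_{FK}`, `r_E := r_{FE}` (module docstrings of FILES 153 ∕ 156 for `Θ₁₅₃`, `Θ_D`).
[cite: Balaban1985BackgroundPropagators, Thm 3.14 pp.426–427 (difference template), (3.42) p.397 (entry `G∇*_U`), (3.52) p.400, (3.62)–(3.65) pp.402–403, (3.76)–(3.77) pp.405–406, (3.87) p.409; Balaban1984PropagatorsII, (2.91)–(2.93) p.239, (2.133)–(2.136) p.247 (shapes + mechanism, transposed)] -/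
theorem hasMaj_idef_rightInverse_bgrad_smoothCutDressed (htri : Triangle254 g) (hd : ∀ a b : g.Site, 0 ≤ g.dist a b) (hsymm : ∀ y y', g.dist y y' = g.dist y' y) (hd0 : ∀ y : g.Site, g.dist y y = 0) (hrow : RowSum g σ cr) (hσ : 0 ≤ σ)
    {ρ₁ ρ₂ ρ₃ ρN δV δN δW ε R c₀ c₁ c₂ o₀ o₁ o₂ o cN rN rA oAt RN rV ℓ ω β β₁ ct δ βQ θA mX mQ r𝒲 oχ θF εF rFK rFE os oχc Nov : ℝ}
    (hβ : 0 ≤ β) (hβ₁ : 0 ≤ β₁) (hβQ : 0 ≤ βQ) (hct : 0 ≤ ct) (hR : 0 ≤ R) (hcr : 0 ≤ cr) (hc₀ : 0 ≤ c₀) (hc₁ : 0 ≤ c₁) (hc₂ : 0 ≤ c₂) (ho₀ : 0 ≤ o₀) (ho₁ : 0 ≤ o₁) (ho₂ : 0 ≤ o₂) (ho : 0 ≤ o)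
    (hcN : 0 ≤ cN) (hrN : 0 ≤ rN) (hrA : 0 ≤ rA) (hoAt : 0 ≤ oAt) (hRN : 0 ≤ RN) (hrV : 0 ≤ rV) (hℓ : 0 ≤ ℓ) (hω : 0 ≤ ω) (hθA : 0 ≤ θA) (hmX : 0 ≤ mX) (hmQ : 0 ≤ mQ) (hr𝒲 : 0 ≤ r𝒲)
    (hoχ : 0 ≤ oχ) (hε : 0 < ε) (hθF : 0 ≤ θF) (hεF : 0 ≤ εF) (hrFK : 0 ≤ rFK) (hrFE : 0 ≤ rFE) (hos : 0 ≤ os) (hoχc : 0 ≤ oχc) (hNov : 0 ≤ Nov) (hσρ : σ ≤ ρ₁) (hρ₁V : ρ₁ ≤ δV)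
    (hρ₁G : ρ₁ + σ ≤ δ) (hρ₂ : 0 ≤ ρ₂) (hρ₂₁ : ρ₂ + σ ≤ ρ₁) (hρ₃ : 0 ≤ ρ₃) (hρ₃N : ρ₃ ≤ ρN) (hρ₃V : ρ₃ ≤ δN - ε) (hρ₃₂ : ρ₃ + σ ≤ ρ₂) (hρ₂W : ρ₂ + 2 * σ ≤ δW) (hσρ₃ : 2 * σ ≤ ρ₃)
    (hSχ : ∀ q, ∀ x, (χX q) x ≠ 0 → blk x ∈ (Sk q)) (hSψ₂ : ∀ q, ∀ x, (ψ₂X q) x ≠ 0 → blk x ∈ (Sk q)) (hχt : ∀ q, ∀ x, |(χtX q) x| ≤ 1)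
    (hdχt : ∀ q, ∀ μ p, |fgrad n (liftEquiv (τ μ) ι) (fun p : X × ι => (χtX q) p.1) p| ≤ ct) (hdχtb : ∀ q, ∀ μ p, |bgrad n (liftEquiv (τ μ) ι) (fun p : X × ι => (χtX q) p.1) p| ≤ ct)
    (hsub : ∀ q, mulOp (fun p : X × ι => (χtX q) p.1) ∘ₗ mulOp (fun p : X × ι => (χX q) p.1) = mulOp (fun p : X × ι => (χtX q) p.1))
    (hχ : ∀ q, mulOp (fun p : X × ι => (χX q) p.1) ∘ₗ mulOp (fun p : X × ι => (χtX q) p.1) = mulOp (fun p : X × ι => (χtX q) p.1))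
    (hs : ∀ q, ∀ μ, mulOp ((fun p : X × ι => (χtX q) p.1) ∘ (liftEquiv (τ μ) ι)) ∘ₗ mulOp (fun p : X × ι => (χX q) p.1) = mulOp ((fun p : X × ι => (χtX q) p.1) ∘ (liftEquiv (τ μ) ι)))
    (hsb : ∀ q, ∀ μ, mulOp ((fun p : X × ι => (χtX q) p.1) ∘ (liftEquiv (τ μ) ι).symm) ∘ₗ mulOp (fun p : X × ι => (χX q) p.1) = mulOp ((fun p : X × ι => (χtX q) p.1) ∘ (liftEquiv (τ μ) ι).symm))
    (hdd : ∀ q, ∀ μ, mulOp (fgrad n (liftEquiv (τ μ) ι) (fun p : X × ι => (χtX q) p.1)) ∘ₗ mulOp (fun p : X × ι => (χX q) p.1) = mulOp (fgrad n (liftEquiv (τ μ) ι) (fun p : X × ι => (χtX q) p.1)))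
    (hddb : ∀ q, ∀ μ, mulOp (bgrad n (liftEquiv (τ μ) ι) (fun p : X × ι => (χtX q) p.1)) ∘ₗ mulOp (fun p : X × ι => (χX q) p.1) = mulOp (bgrad n (liftEquiv (τ μ) ι) (fun p : X × ι => (χtX q) p.1)))
    (hSχ' : ∀ q, ∀ x', (χX' q) x' ≠ 0 → blk (π x') ∈ (Sk q)) (hSψ' : ∀ q, ∀ x', (ψX' q) x' ≠ 0 → blk (π x') ∈ (Sk q)) (hSψ₂' : ∀ q, ∀ x', (ψ₂X' q) x' ≠ 0 → blk (π x') ∈ (Sk q))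
    (hχt' : ∀ q, ∀ x', |(χtX' q) x'| ≤ 1) (hdχt' : ∀ q, ∀ μ p', |fgrad n' (liftEquiv (τ' μ) ι) (fun p : X' × ι => (χtX' q) p.1) p'| ≤ ct)
    (hdχtb' : ∀ q, ∀ μ p', |bgrad n' (liftEquiv (τ' μ) ι) (fun p : X' × ι => (χtX' q) p.1) p'| ≤ ct)
    (hsub' : ∀ q, mulOp (fun p : X' × ι => (χtX' q) p.1) ∘ₗ mulOp (fun p : X' × ι => (χX' q) p.1) = mulOp (fun p : X' × ι => (χtX' q) p.1))
    (hχ' : ∀ q, mulOp (fun p : X' × ι => (χX' q) p.1) ∘ₗ mulOp (fun p : X' × ι => (χtX' q) p.1) = mulOp (fun p : X' × ι => (χtX' q) p.1))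
    (hs' : ∀ q, ∀ μ, mulOp ((fun p : X' × ι => (χtX' q) p.1) ∘ (liftEquiv (τ' μ) ι)) ∘ₗ mulOp (fun p : X' × ι => (χX' q) p.1) = mulOp ((fun p : X' × ι => (χtX' q) p.1) ∘ (liftEquiv (τ' μ) ι)))
    (hsb' : ∀ q, ∀ μ, mulOp ((fun p : X' × ι => (χtX' q) p.1) ∘ (liftEquiv (τ' μ) ι).symm) ∘ₗ mulOp (fun p : X' × ι => (χX' q) p.1) = mulOp ((fun p : X' × ι => (χtX' q) p.1) ∘ (liftEquiv (τ' μ) ι).symm))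
    (hdd' : ∀ q, ∀ μ, mulOp (fgrad n' (liftEquiv (τ' μ) ι) (fun p : X' × ι => (χtX' q) p.1)) ∘ₗ mulOp (fun p : X' × ι => (χX' q) p.1) = mulOp (fgrad n' (liftEquiv (τ' μ) ι) (fun p : X' × ι => (χtX' q) p.1)))
    (hddb' : ∀ q, ∀ μ, mulOp (bgrad n' (liftEquiv (τ' μ) ι) (fun p : X' × ι => (χtX' q) p.1)) ∘ₗ mulOp (fun p : X' × ι => (χX' q) p.1) = mulOp (bgrad n' (liftEquiv (τ' μ) ι) (fun p : X' × ι => (χtX' q) p.1)))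
    (hNψ' : ∀ q, (N' q) ∘ₗ mulOp (fun p : X' × ι => (ψX' q) p.1) = (N' q)) (hfitχ : ∀ q, ∀ x', |(χtX' q) x' - (χtX q) (π x')| ≤ oχ)
    (hcut : ∀ q, HasMaj (BlockNorm.ofBlocks g (liftBlk blk ι)) (BlockNorm.ofBlocks g (liftBlk blk ι)) (mulOp (fun p : X × ι => (χX q) p.1) ∘ₗ (N q)) (fun y y' => ind (Sk q) y * ind (Sk q) y' * (β * Real.exp (-(δ * g.dist y y')))))
    (hcutF : ∀ q, ∀ μ, HasMaj (BlockNorm.ofBlocks g (liftBlk blk ι)) (BlockNorm.ofBlocks g (liftBlk blk ι)) (mulOp (fun p : X × ι => (χX q) p.1) ∘ₗ (fgrad n (liftEquiv (τ μ) ι) ∘ₗ (N q)))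
      (fun y y' => ind (Sk q) y * ind (Sk q) y' * (β₁ * Real.exp (-(δ * g.dist y y')))))
    (hcutB : ∀ q, ∀ μ, HasMaj (BlockNorm.ofBlocks g (liftBlk blk ι)) (BlockNorm.ofBlocks g (liftBlk blk ι)) (mulOp (fun p : X × ι => (χX q) p.1) ∘ₗ (bgrad n (liftEquiv (τ μ) ι) ∘ₗ (N q)))
      (fun y y' => ind (Sk q) y * ind (Sk q) y' * (β₁ * Real.exp (-(δ * g.dist y y')))))
    (hcut' : ∀ q, HasMaj (BlockNorm.ofBlocks g (liftBlk (blk ∘ π) ι)) (BlockNorm.ofBlocks g (liftBlk (blk ∘ π) ι)) (mulOp (fun p : X' × ι => (χX' q) p.1) ∘ₗ (N' q)) (fun y y' => ind (Sk q) y * ind (Sk q) y' * (β * Real.exp (-(δ * g.dist y y')))))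
    (hcutF' : ∀ q, ∀ μ, HasMaj (BlockNorm.ofBlocks g (liftBlk (blk ∘ π) ι)) (BlockNorm.ofBlocks g (liftBlk (blk ∘ π) ι)) (mulOp (fun p : X' × ι => (χX' q) p.1) ∘ₗ (fgrad n' (liftEquiv (τ' μ) ι) ∘ₗ (N' q)))
      (fun y y' => ind (Sk q) y * ind (Sk q) y' * (β₁ * Real.exp (-(δ * g.dist y y')))))
    (hcutB' : ∀ q, ∀ μ, HasMaj (BlockNorm.ofBlocks g (liftBlk (blk ∘ π) ι)) (BlockNorm.ofBlocks g (liftBlk (blk ∘ π) ι)) (mulOp (fun p : X' × ι => (χX' q) p.1) ∘ₗ (bgrad n' (liftEquiv (τ' μ) ι) ∘ₗ (N' q)))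
      (fun y y' => ind (Sk q) y * ind (Sk q) y' * (β₁ * Real.exp (-(δ * g.dist y y')))))
    (hTf : ∀ q, ∀ μ, (N q) ∘ₗ fgrad n (liftEquiv (τ μ) ι) ∘ₗ mulOp (fun p : X × ι => (χX q) p.1) = (Tf q) μ ∘ₗ mulOp (fun p : X × ι => (χX q) p.1))
    (hTb : ∀ q, ∀ μ, (N q) ∘ₗ bgrad n (liftEquiv (τ μ) ι) ∘ₗ mulOp (fun p : X × ι => (χX q) p.1) = (Tb q) μ ∘ₗ mulOp (fun p : X × ι => (χX q) p.1))
    (hTf' : ∀ q, ∀ μ, (N' q) ∘ₗ fgrad n' (liftEquiv (τ' μ) ι) ∘ₗ mulOp (fun p : X' × ι => (χX' q) p.1) = (Tf' q) μ ∘ₗ mulOp (fun p : X' × ι => (χX' q) p.1))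
    (hTb' : ∀ q, ∀ μ, (N' q) ∘ₗ bgrad n' (liftEquiv (τ' μ) ι) ∘ₗ mulOp (fun p : X' × ι => (χX' q) p.1) = (Tb' q) μ ∘ₗ mulOp (fun p : X' × ι => (χX' q) p.1))
    (hTfr : ∀ q, ∀ μ, HasMaj (BlockNorm.ofBlocks g (liftBlk blk ι)) (BlockNorm.ofBlocks g (liftBlk blk ι)) ((Tf q) μ) (fun y y' => ind (Sk q) y * ind (Sk q) y' * (βQ * Real.exp (-(δW * g.dist y y')))))
    (hTbr : ∀ q, ∀ μ, HasMaj (BlockNorm.ofBlocks g (liftBlk blk ι)) (BlockNorm.ofBlocks g (liftBlk blk ι)) ((Tb q) μ) (fun y y' => ind (Sk q) y * ind (Sk q) y' * (βQ * Real.exp (-(δW * g.dist y y')))))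
    (hTfr' : ∀ q, ∀ μ, HasMaj (BlockNorm.ofBlocks g (liftBlk (blk ∘ π) ι)) (BlockNorm.ofBlocks g (liftBlk (blk ∘ π) ι)) ((Tf' q) μ) (fun y y' => ind (Sk q) y * ind (Sk q) y' * (βQ * Real.exp (-(δW * g.dist y y')))))
    (hTbr' : ∀ q, ∀ μ, HasMaj (BlockNorm.ofBlocks g (liftBlk (blk ∘ π) ι)) (BlockNorm.ofBlocks g (liftBlk (blk ∘ π) ι)) ((Tb' q) μ) (fun y y' => ind (Sk q) y * ind (Sk q) y' * (βQ * Real.exp (-(δW * g.dist y y')))))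
    (hTfψ : ∀ q, ∀ μ, (Tf q) μ ∘ₗ mulOp (fun p : X × ι => (ψ₂X q) p.1) = (Tf q) μ) (hTbψ : ∀ q, ∀ μ, (Tb q) μ ∘ₗ mulOp (fun p : X × ι => (ψ₂X q) p.1) = (Tb q) μ)
    (hTfψ' : ∀ q, ∀ μ, (Tf' q) μ ∘ₗ mulOp (fun p : X' × ι => (ψ₂X' q) p.1) = (Tf' q) μ) (hTbψ' : ∀ q, ∀ μ, (Tb' q) μ ∘ₗ mulOp (fun p : X' × ι => (ψ₂X' q) p.1) = (Tb' q) μ)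
    (hDTf : ∀ q, ∀ μ, HasMaj (BlockNorm.ofBlocks g (liftBlk blk ι)) (BlockNorm.ofBlocks g (liftBlk (blk ∘ π) ι)) (idef (pull (liftMap π ι)) (pull (liftMap π ι)) ((Tf' q) μ) ((Tf q) μ)) (fun y y' => mQ * Real.exp (-(δW * g.dist y y'))))
    (hDTb : ∀ q, ∀ μ, HasMaj (BlockNorm.ofBlocks g (liftBlk blk ι)) (BlockNorm.ofBlocks g (liftBlk (blk ∘ π) ι)) (idef (pull (liftMap π ι)) (pull (liftMap π ι)) ((Tb' q) μ) ((Tb q) μ)) (fun y y' => mQ * Real.exp (-(δW * g.dist y y'))))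
    (hV : ∀ q, HasMaj (BlockNorm.ofBlocks g (blkPair (liftBlk blk ι))) (BlockNorm.ofBlocks g (liftBlk blk ι)) (unstackM (C q) (A q) + (NV q) ∘ₗ projO (none : Option (J ⊕ J))) (fun y y' => R * Real.exp (-(δV * g.dist y y'))))
    (hV' : ∀ q, HasMaj (BlockNorm.ofBlocks g (blkPair (liftBlk (blk ∘ π) ι))) (BlockNorm.ofBlocks g (liftBlk (blk ∘ π) ι)) (unstackM (C' q) (A' q) + (NV' q) ∘ₗ projO (none : Option (J ⊕ J))) (fun y y' => R * Real.exp (-(δV * g.dist y y'))))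
    (hq : (β + (β₁ + ct * β)) * (R * cr) * cr < 1)
    (hW𝒲 : ∀ q, HasMaj (BlockNorm.ofBlocks g (liftBlk blk ι)) (BlockNorm.ofBlocks g (liftBlk blk ι))
      ((mulOp (fun p : X × ι => (χtX q) p.1) ∘ₗ (N q)) ∘ₗ (unstackM (C q) (A q) + (NV q) ∘ₗ projO (none : Option (J ⊕ J))) ∘ₗ
        stack LinearMap.id (fun j => Sum.elim (fun μ => fgrad n (liftEquiv (τ μ) ι)) (fun μ => bgrad n (liftEquiv (τ μ) ι)) j) ∘ₗ mulOp (fun p : X × ι => (χX q) p.1))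
      (fun y y' => θA * Real.exp (-(δW * g.dist y y'))))
    (hW𝒲' : ∀ q, HasMaj (BlockNorm.ofBlocks g (liftBlk (blk ∘ π) ι)) (BlockNorm.ofBlocks g (liftBlk (blk ∘ π) ι))
      ((mulOp (fun p : X' × ι => (χtX' q) p.1) ∘ₗ (N' q)) ∘ₗ (unstackM (C' q) (A' q) + (NV' q) ∘ₗ projO (none : Option (J ⊕ J))) ∘ₗ
        stack LinearMap.id (fun j => Sum.elim (fun μ => fgrad n' (liftEquiv (τ' μ) ι)) (fun μ => bgrad n' (liftEquiv (τ' μ) ι)) j) ∘ₗ mulOp (fun p : X' × ι => (χX' q) p.1))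
      (fun y y' => θA * Real.exp (-(δW * g.dist y y'))))
    (hqA : θA * cr < 1)
    (hD𝒲 : ∀ q, HasMaj (BlockNorm.ofBlocks g (liftBlk blk ι)) (BlockNorm.ofBlocks g (liftBlk (blk ∘ π) ι))
      (idef (pull (liftMap π ι)) (pull (liftMap π ι))
        ((mulOp (fun p : X' × ι => (χtX' q) p.1) ∘ₗ (N' q)) ∘ₗ (unstackM (C' q) (A' q) + (NV' q) ∘ₗ projO (none : Option (J ⊕ J))) ∘ₗ
        stack LinearMap.id (fun j => Sum.elim (fun μ => fgrad n' (liftEquiv (τ' μ) ι)) (fun μ => bgrad n' (liftEquiv (τ' μ) ι)) j) ∘ₗ mulOp (fun p : X' × ι => (χX' q) p.1))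
        ((mulOp (fun p : X × ι => (χtX q) p.1) ∘ₗ (N q)) ∘ₗ (unstackM (C q) (A q) + (NV q) ∘ₗ projO (none : Option (J ⊕ J))) ∘ₗ
        stack LinearMap.id (fun j => Sum.elim (fun μ => fgrad n (liftEquiv (τ μ) ι)) (fun μ => bgrad n (liftEquiv (τ μ) ι)) j) ∘ₗ mulOp (fun p : X × ι => (χX q) p.1)))
      (fun y y' => r𝒲 * Real.exp (-(δW * g.dist y y'))))
    (hDG0 : ∀ q, HasMaj (BlockNorm.ofBlocks g (liftBlk blk ι)) (BlockNorm.ofBlocks g (liftBlk (blk ∘ π) ι))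
      (idef (pull (liftMap π ι)) (pull (liftMap π ι))
        (projO none ∘ₗ bgPropV (stack (mulOp (fun p : X' × ι => (χtX' q) p.1) ∘ₗ (N' q))
          (fun j => Sum.elim (fun μ => fgrad n' (liftEquiv (τ' μ) ι)) (fun μ => bgrad n' (liftEquiv (τ' μ) ι)) j ∘ₗ (mulOp (fun p : X' × ι => (χtX' q) p.1) ∘ₗ (N' q)))) (unstackM (C' q) (A' q) + (NV' q) ∘ₗ projO (none : Option (J ⊕ J))))
        (projO none ∘ₗ bgPropV (stack (mulOp (fun p : X × ι => (χtX q) p.1) ∘ₗ (N q))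
          (fun j => Sum.elim (fun μ => fgrad n (liftEquiv (τ μ) ι)) (fun μ => bgrad n (liftEquiv (τ μ) ι)) j ∘ₗ (mulOp (fun p : X × ι => (χtX q) p.1) ∘ₗ (N q)))) (unstackM (C q) (A q) + (NV q) ∘ₗ projO (none : Option (J ⊕ J)))))
      (fun y y' => ind (Sk q) y * ind (Sk q) y' * (mX * Real.exp (-(ρ₂ * g.dist y y')))))
    (hhD : ∀ q, ∀ μ p, |(fgrad n (liftEquiv (τ μ) ι) (fun p : X × ι => (hX q) p.1) ∘ ⇑(liftEquiv (τ μ) ι).symm) p| ≤ c₁)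
    (hhB : ∀ q, ∀ μ p, |(bgrad n (liftEquiv (τ μ) ι) (fun p : X × ι => (hX q) p.1) ∘ ⇑(liftEquiv (τ μ) ι)) p| ≤ c₁)
    (hh2 : ∀ q, ∀ μ p, |fgradAdj n (liftEquiv (τ μ) ι) (fgrad n (liftEquiv (τ μ) ι) (fun p : X × ι => (hX q) p.1)) p| ≤ c₂)
    (hh2f : ∀ q, ∀ μ p, |(fgrad n (liftEquiv (τ μ) ι) (fgrad n (liftEquiv (τ μ) ι) (fun p : X × ι => (hX q) p.1)) ∘ ⇑(liftEquiv (τ μ) ι).symm) p| ≤ c₂)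
    (hh2b : ∀ q, ∀ μ p, |bgrad n (liftEquiv (τ μ) ι) (bgrad n (liftEquiv (τ μ) ι) (fun p : X × ι => (hX q) p.1) ∘ ⇑(liftEquiv (τ μ) ι)) p| ≤ c₂)
    (hfD : ∀ q, ∀ μ p', |(fgrad n' (liftEquiv (τ' μ) ι) (fun p : X' × ι => (hX' q) p.1) ∘ ⇑(liftEquiv (τ' μ) ι).symm) p' - (fgrad n (liftEquiv (τ μ) ι) (fun p : X × ι => (hX q) p.1) ∘ ⇑(liftEquiv (τ μ) ι).symm) (liftMap π ι p')| ≤ o₁)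
    (hfB : ∀ q, ∀ μ p', |(bgrad n' (liftEquiv (τ' μ) ι) (fun p : X' × ι => (hX' q) p.1) ∘ ⇑(liftEquiv (τ' μ) ι)) p' - (bgrad n (liftEquiv (τ μ) ι) (fun p : X × ι => (hX q) p.1) ∘ ⇑(liftEquiv (τ μ) ι)) (liftMap π ι p')| ≤ o₁)
    (hf2 : ∀ q, ∀ μ p', |fgradAdj n' (liftEquiv (τ' μ) ι) (fgrad n' (liftEquiv (τ' μ) ι) (fun p : X' × ι => (hX' q) p.1)) p' - fgradAdj n (liftEquiv (τ μ) ι) (fgrad n (liftEquiv (τ μ) ι) (fun p : X × ι => (hX q) p.1)) (liftMap π ι p')| ≤ o₂)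
    (hf2f : ∀ q, ∀ μ p', |(fgrad n' (liftEquiv (τ' μ) ι) (fgrad n' (liftEquiv (τ' μ) ι) (fun p : X' × ι => (hX' q) p.1)) ∘ ⇑(liftEquiv (τ' μ) ι).symm) p' -
      (fgrad n (liftEquiv (τ μ) ι) (fgrad n (liftEquiv (τ μ) ι) (fun p : X × ι => (hX q) p.1)) ∘ ⇑(liftEquiv (τ μ) ι).symm) (liftMap π ι p')| ≤ o₂)
    (hf2b : ∀ q, ∀ μ p', |bgrad n' (liftEquiv (τ' μ) ι) (bgrad n' (liftEquiv (τ' μ) ι) (fun p : X' × ι => (hX' q) p.1) ∘ ⇑(liftEquiv (τ' μ) ι)) p' -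
      bgrad n (liftEquiv (τ μ) ι) (bgrad n (liftEquiv (τ μ) ι) (fun p : X × ι => (hX q) p.1) ∘ ⇑(liftEquiv (τ μ) ι)) (liftMap π ι p')| ≤ o₂)
    (hh1 : ∀ q, ∀ μ x, |fgrad n (τ μ) (hX q) x| ≤ c₁) (hh1b : ∀ q, ∀ μ x, |bgrad n (τ μ) (hX q) x| ≤ c₁) (hh0 : ∀ q, ∀ μ x, |(hX q) (τ μ x) - (hX q) x| ≤ c₀)
    (hh1' : ∀ q, ∀ μ x', |fgrad n' (τ' μ) (hX' q) x'| ≤ c₁) (hh1b' : ∀ q, ∀ μ x', |bgrad n' (τ' μ) (hX' q) x'| ≤ c₁) (hh0' : ∀ q, ∀ μ x', |(hX' q) (τ' μ x') - (hX' q) x'| ≤ c₀)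
    (hf1 : ∀ q, ∀ μ x', |fgrad n' (τ' μ) (hX' q) x' - fgrad n (τ μ) (hX q) (π x')| ≤ o₁) (hf1b : ∀ q, ∀ μ x', |bgrad n' (τ' μ) (hX' q) x' - bgrad n (τ μ) (hX q) (π x')| ≤ o₁)
    (hf0 : ∀ q, ∀ μ x', |((hX' q) (τ' μ x') - (hX' q) x') - ((hX q) (τ μ (π x')) - (hX q) (π x'))| ≤ o₀)
    (hf0b : ∀ q, ∀ μ x', |((hX' q) x' - (hX' q) ((τ' μ).symm x')) - ((hX q) (π x') - (hX q) ((τ μ).symm (π x')))| ≤ o₀)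
    (hfit : ∀ q, ∀ x', |(hX' q) x' - (hX q) (π x')| ≤ o) (hLip : ∀ q, ∀ y y', |(hb q) y - (hb q) y'| ≤ ℓ * g.dist y y') (hrh : ∀ q, ∀ x, |(hX q) x - (hb q) (blk x)| ≤ ω)
    (hrh' : ∀ q, ∀ x', |(hX' q) x' - (hb q) (blk (π x'))| ≤ ω) (hlayf : ∀ q, ∀ μ x, (hX q) x ≠ (hX q) ((τ μ).symm x) → (χX q) x = 1)
    (hlayb : ∀ q, ∀ μ x, (hX q) (τ μ x) ≠ (hX q) x → (χX q) x = 1) (hlayf' : ∀ q, ∀ μ x', (hX' q) x' ≠ (hX' q) ((τ' μ).symm x') → (χX' q) x' = 1)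
    (hlayb' : ∀ q, ∀ μ x', (hX' q) (τ' μ x') ≠ (hX' q) x' → (χX' q) x' = 1) (hA : ∀ q, ∀ j x i, ∑ k, |(A q) j x i k| ≤ rA)
    (hfAb : ∀ q, ∀ μ x' i, ∑ k, |(A' q) (Sum.inl μ) ((τ' μ).symm x') i k - (A q) (Sum.inl μ) ((τ μ).symm (π x')) i k| ≤ oAt)
    (hfAf : ∀ q, ∀ μ x' i, ∑ k, |(A' q) (Sum.inr μ) (τ' μ x') i k - (A q) (Sum.inr μ) (τ μ (π x')) i k| ≤ oAt)
    (hKN : ∀ q, HasMaj (BlockNorm.ofBlocks g (liftBlk blk ι)) (BlockNorm.ofBlocks g (liftBlk blk ι)) (commOp NL (fun p : X × ι => (hX q) p.1)) (fun y y' => cN * Real.exp (-(ρN * g.dist y y'))))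
    (hDKN : ∀ q, HasMaj (BlockNorm.ofBlocks g (liftBlk blk ι)) (BlockNorm.ofBlocks g (liftBlk (blk ∘ π) ι))
      (idef (pull (liftMap π ι)) (pull (liftMap π ι)) (commOp NL' (fun p : X' × ι => (hX' q) p.1)) (commOp NL (fun p : X × ι => (hX q) p.1))) (fun y y' => rN * Real.exp (-(ρN * g.dist y y'))))
    (hNV : ∀ q, HasMaj (BlockNorm.ofBlocks g (liftBlk blk ι)) (BlockNorm.ofBlocks g (liftBlk blk ι)) (NV q) (fun y y' => RN * Real.exp (-(δN * g.dist y y'))))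
    (hNV' : ∀ q, HasMaj (BlockNorm.ofBlocks g (liftBlk (blk ∘ π) ι)) (BlockNorm.ofBlocks g (liftBlk (blk ∘ π) ι)) (NV' q) (fun y y' => RN * Real.exp (-(δN * g.dist y y'))))
    (hDNV : ∀ q, HasMaj (BlockNorm.ofBlocks g (liftBlk blk ι)) (BlockNorm.ofBlocks g (liftBlk (blk ∘ π) ι)) (idef (pull (liftMap π ι)) (pull (liftMap π ι)) (NV' q) (NV q)) (fun y y' => rV * Real.exp (-(δN * g.dist y y'))))
    -- per cube: coarse plateau support ∕ input cut (for the coarse cut row), sharp-cut letters and fit, the partition's absolute letters, its cut, the `ν`-shifted supports and fit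
    (hSψ : ∀ q, ∀ x, (ψX q) x ≠ 0 → blk x ∈ (Sk q)) (hNψ : ∀ q, (N q) ∘ₗ mulOp (fun p : X × ι => (ψX q) p.1) = (N q)) (hχ1 : ∀ q x, |χX q x| ≤ 1) (hχ1' : ∀ q x', |χX' q x'| ≤ 1)
    (hfitχc : ∀ q x', |χX' q x' - χX q (π x')| ≤ oχc) (hhabs : ∀ q x, |hX q x| ≤ 1) (hhabs' : ∀ q x', |hX' q x'| ≤ 1)
    (hhcut : ∀ q, mulOp (fun p : X × ι => (hX q) p.1) ∘ₗ mulOp (fun p : X × ι => (χX q) p.1) = mulOp (fun p : X × ι => (hX q) p.1))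
    (hhcut' : ∀ q, mulOp (fun p : X' × ι => (hX' q) p.1) ∘ₗ mulOp (fun p : X' × ι => (χX' q) p.1) = mulOp (fun p : X' × ι => (hX' q) p.1))
    (hlayν : ∀ q x, hX q (τ ν x) ≠ 0 → χX q x = 1) (hlayν' : ∀ q x', hX' q (τ' ν x') ≠ 0 → χX' q x' = 1) (hfits : ∀ q x', |hX' q (τ' ν x') - hX q (τ ν (π x'))| ≤ os)
    (hh2' : ∀ q, ∀ μ p', |fgradAdj n' (liftEquiv (τ' μ) ι) (fgrad n' (liftEquiv (τ' μ) ι) (fun p : X' × ι => (hX' q) p.1)) p'| ≤ c₂)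
    (hh2f' : ∀ q, ∀ μ p', |fgrad n' (liftEquiv (τ' μ) ι) (fgrad n' (liftEquiv (τ' μ) ι) (fun p : X' × ι => (hX' q) p.1)) p'| ≤ c₂)
    (hh2b' : ∀ q, ∀ μ p', |bgrad n' (liftEquiv (τ' μ) ι) (bgrad n' (liftEquiv (τ' μ) ι) (fun p : X' × ι => (hX' q) p.1) ∘ ⇑(liftEquiv (τ' μ) ι)) p'| ≤ c₂)
    (hA' : ∀ q, ∀ j x' i, ∑ k, |(A' q) j x' i k| ≤ rA)
    (hKN' : ∀ q, HasMaj (BlockNorm.ofBlocks g (liftBlk (blk ∘ π) ι)) (BlockNorm.ofBlocks g (liftBlk (blk ∘ π) ι)) (commOp NL' (fun p : X' × ι => (hX' q) p.1)) (fun y y' => cN * Real.exp (-(ρN * g.dist y y'))))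
    (hFK : ∀ q, HasMaj (BlockNorm.ofBlocks g (liftBlk blk ι)) (BlockNorm.ofBlocks g (liftBlk blk ι)) ((projO none ∘ₗ bgPropV (stack (mulOp (fun p : X × ι => (χtX q) p.1) ∘ₗ (N q)) (fun j => Sum.elim (fun μ => fgrad n (liftEquiv (τ μ) ι)) (fun μ => bgrad n (liftEquiv (τ μ) ι)) j ∘ₗ (mulOp (fun p : X × ι => (χtX q) p.1) ∘ₗ (N q)))) (unstackM ((C q)) ((A q)) + (NV q) ∘ₗ projO (none : Option (J ⊕ J)))) ∘ₗ commOp (F q) (fun p : X × ι => (hX q) p.1)) (fun y y' => ind (Sk q) y * (θF * Real.exp (-(ρ₃ * g.dist y y')))))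
    (hFK' : ∀ q, HasMaj (BlockNorm.ofBlocks g (liftBlk (blk ∘ π) ι)) (BlockNorm.ofBlocks g (liftBlk (blk ∘ π) ι)) ((projO none ∘ₗ bgPropV (stack (mulOp (fun p : X' × ι => (χtX' q) p.1) ∘ₗ (N' q)) (fun j => Sum.elim (fun μ => fgrad n' (liftEquiv (τ' μ) ι)) (fun μ => bgrad n' (liftEquiv (τ' μ) ι)) j ∘ₗ (mulOp (fun p : X' × ι => (χtX' q) p.1) ∘ₗ (N' q)))) (unstackM ((C' q)) ((A' q)) + (NV' q) ∘ₗ projO (none : Option (J ⊕ J)))) ∘ₗ commOp (F' q) (fun p : X' × ι => (hX' q) p.1)) (fun y y' => ind (Sk q) y * (θF * Real.exp (-(ρ₃ * g.dist y y')))))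
    (hDFK : ∀ q, HasMaj (BlockNorm.ofBlocks g (liftBlk blk ι)) (BlockNorm.ofBlocks g (liftBlk (blk ∘ π) ι)) (idef (pull (liftMap π ι)) (pull (liftMap π ι)) ((projO none ∘ₗ bgPropV (stack (mulOp (fun p : X' × ι => (χtX' q) p.1) ∘ₗ (N' q)) (fun j => Sum.elim (fun μ => fgrad n' (liftEquiv (τ' μ) ι)) (fun μ => bgrad n' (liftEquiv (τ' μ) ι)) j ∘ₗ (mulOp (fun p : X' × ι => (χtX' q) p.1) ∘ₗ (N' q)))) (unstackM ((C' q)) ((A' q)) + (NV' q) ∘ₗ projO (none : Option (J ⊕ J)))) ∘ₗ commOp (F' q) (fun p : X' × ι => (hX' q) p.1)) ((projO none ∘ₗ bgPropV (stack (mulOp (fun p : X × ι => (χtX q) p.1) ∘ₗ (N q)) (fun j => Sum.elim (fun μ => fgrad n (liftEquiv (τ μ) ι)) (fun μ => bgrad n (liftEquiv (τ μ) ι)) j ∘ₗ (mulOp (fun p : X × ι => (χtX q) p.1) ∘ₗ (N q)))) (unstackM ((C q)) ((A q)) + (NV q) ∘ₗ projO (none : Option (J ⊕ J)))) ∘ₗ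 commOp (F q) (fun p : X × ι => (hX q) p.1))) (fun y y' => ind (Sk q) y * (rFK * Real.exp (-(ρ₃ * g.dist y y')))))
    (hN : ∀ a, ∑ q, ind (Sk q) a ≤ Nov)
    -- THE GLOBAL OPERATORS read in each cube = model + far defect `F`; the TRUE right-locality defects `Ẽ` and their rows ∕ η-defect; partition of unity; right inverses at both grids; ONE smallness
    (hcov : ∀ q, Δ = (lapOp n (fun μ => liftEquiv (τ μ) ι) 0 + NL - (unstackM ((C q)) ((A q)) + (NV q) ∘ₗ projO (none : Option (J ⊕ J))) ∘ₗ stack LinearMap.id (fun j => Sum.elim (fun μ => fgrad n (liftEquiv (τ μ) ι)) (fun μ => bgrad n (liftEquiv (τ μ) ι)) j)) + (F q))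
    (hcov' : ∀ q, Δ' = (lapOp n' (fun μ => liftEquiv (τ' μ) ι) 0 + NL' - (unstackM ((C' q)) ((A' q)) + (NV' q) ∘ₗ projO (none : Option (J ⊕ J))) ∘ₗ stack LinearMap.id (fun j => Sum.elim (fun μ => fgrad n' (liftEquiv (τ' μ) ι)) (fun μ => bgrad n' (liftEquiv (τ' μ) ι)) j)) + (F' q))
    (hloc : ∀ q, (projO none ∘ₗ bgPropV (stack (mulOp (fun p : X × ι => (χtX q) p.1) ∘ₗ (N q)) (fun j => Sum.elim (fun μ => fgrad n (liftEquiv (τ μ) ι)) (fun μ => bgrad n (liftEquiv (τ μ) ι)) j ∘ₗ (mulOp (fun p : X × ι => (χtX q) p.1) ∘ₗ (N q)))) (unstackM ((C q)) ((A q)) + (NV q) ∘ₗ projO (none : Option (J ⊕ J)))) ∘ₗ Δ ∘ₗ mulOp (fun p : X × ι => (hX q) p.1) = mulOp (fun p : X × ι => (hX q) p.1) + Ed q)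
    (hloc' : ∀ q, (projO none ∘ₗ bgPropV (stack (mulOp (fun p : X' × ι => (χtX' q) p.1) ∘ₗ (N' q)) (fun j => Sum.elim (fun μ => fgrad n' (liftEquiv (τ' μ) ι)) (fun μ => bgrad n' (liftEquiv (τ' μ) ι)) j ∘ₗ (mulOp (fun p : X' × ι => (χtX' q) p.1) ∘ₗ (N' q)))) (unstackM ((C' q)) ((A' q)) + (NV' q) ∘ₗ projO (none : Option (J ⊕ J)))) ∘ₗ Δ' ∘ₗ mulOp (fun p : X' × ι => (hX' q) p.1) = mulOp (fun p : X' × ι => (hX' q) p.1) + Ed' q)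
    (hEd : ∀ q, HasMaj (BlockNorm.ofBlocks g (liftBlk blk ι)) (BlockNorm.ofBlocks g (liftBlk blk ι)) (Ed q) (fun y y' => ind (Sk q) y * ind (Sk q) y' * (εF * Real.exp (-(ρ₃ * g.dist y y')))))
    (hEd' : ∀ q, HasMaj (BlockNorm.ofBlocks g (liftBlk (blk ∘ π) ι)) (BlockNorm.ofBlocks g (liftBlk (blk ∘ π) ι)) (Ed' q) (fun y y' => ind (Sk q) y * ind (Sk q) y' * (εF * Real.exp (-(ρ₃ * g.dist y y')))))
    (hDEd : ∀ q, HasMaj (BlockNorm.ofBlocks g (liftBlk blk ι)) (BlockNorm.ofBlocks g (liftBlk (blk ∘ π) ι)) (idef (pull (liftMap π ι)) (pull (liftMap π ι)) (Ed' q) (Ed q)) (fun y y' => ind (Sk q) y * ind (Sk q) y' * (rFE * Real.exp (-(ρ₃ * g.dist y y')))))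
    (h236 : ∀ p : X × ι, ∑ q, (fun p : X × ι => (hX q) p.1) p ^ 2 = 1) (h236' : ∀ p : X' × ι, ∑ q, (fun p : X' × ι => (hX' q) p.1) p ^ 2 = 1) (hY : Δ ∘ₗ Yop = LinearMap.id)
    (hY' : Δ' ∘ₗ Yop' = LinearMap.id)
    (hqL : Nov * ((((((Fintype.card J : ℝ) * (3 * ((β + (β₁ + ct * β)) * (1 - (β + (β₁ + ct * β)) * (R * cr) * cr)⁻¹ * c₂) + 2 * (((1 - θA * cr)⁻¹ * βQ * cr) * c₁)) + 0) + (β + (β₁ + ct * β)) * (1 - (β + (β₁ + ct * β)) * (R * cr) * cr)⁻¹ * cN * cr) + (((Fintype.card J : ℝ) * (2 * rA * (c₁ * ((β + (β₁ + ct * β)) * (1 - (β + (β₁ + ct * β)) * (R * cr) * cr)⁻¹) + c₀ * ((1 - θA * cr)⁻¹ * βQ * cr)))) + (β + (β₁ + ct * β)) * (1 - (β + (β₁ + ct * β)) * (R * cr) * cr)⁻¹ * ((ℓ * (Real.exp 1 * ε)⁻¹ + 2 * ω) * RN) * cr)) + θF) + εF) * cr < 1) :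
    HasMaj (BlockNorm.ofBlocks g (liftBlk blk ι)) (BlockNorm.ofBlocks g (liftBlk (blk ∘ π) ι))
      (idef (pull (liftMap π ι)) (pull (liftMap π ι)) (Yop' ∘ₗ bgrad n' (liftEquiv (τ' ν) ι)) (Yop ∘ₗ bgrad n (liftEquiv (τ ν) ι)))
      (fun y y' => (((1 - Nov * ((((((Fintype.card J : ℝ) * (3 * ((β + (β₁ + ct * β)) * (1 - (β + (β₁ + ct * β)) * (R * cr) * cr)⁻¹ * c₂) + 2 * (((1 - θA * cr)⁻¹ * βQ * cr) * c₁)) + 0) + (β + (β₁ + ct * β)) * (1 - (β + (β₁ + ct * β)) * (R * cr) * cr)⁻¹ * cN * cr) + (((Fintype.card J : ℝ) * (2 * rA * (c₁ * ((β + (β₁ + ct * β)) * (1 - (β + (β₁ + ct * β)) * (R * cr) * cr)⁻¹) + c₀ * ((1 - θA * cr)⁻¹ * βQ * cr)))) + (β + (β₁ + ct * β)) * (1 - (β + (β₁ + ct * β)) * (R * cr) * cr)⁻¹ * ((ℓ * (Real.exp 1 * ε)⁻¹ + 2 * ω) * RN) * cr)) + θF) + εF) * cr)⁻¹ * (Nov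 * ((1 * ((1 - θA * cr)⁻¹ * βQ * cr) * os + 1 * (1 * ((1 - θA * cr)⁻¹ * (1 * mQ + oχ * βQ) * cr + (1 - θA * cr)⁻¹ * (r𝒲 * ((1 - θA * cr)⁻¹ * βQ * cr) * cr) * cr) + oχc * ((1 - θA * cr)⁻¹ * βQ * cr)) * 1 + o * ((1 - θA * cr)⁻¹ * βQ * cr) * 1) + (1 * ((β + (β₁ + ct * β)) * (1 - (β + (β₁ + ct * β)) * (R * cr) * cr)⁻¹) * o₁ + 1 * mX * c₁ + o * ((β + (β₁ + ct * β)) * (1 - (β + (β₁ + ct * β)) * (R * cr) * cr)⁻¹) * c₁))) * cr +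
          (1 - Nov * ((((((Fintype.card J : ℝ) * (3 * ((β + (β₁ + ct * β)) * (1 - (β + (β₁ + ct * β)) * (R * cr) * cr)⁻¹ * c₂) + 2 * (((1 - θA * cr)⁻¹ * βQ * cr) * c₁)) + 0) + (β + (β₁ + ct * β)) * (1 - (β + (β₁ + ct * β)) * (R * cr) * cr)⁻¹ * cN * cr) + (((Fintype.card J : ℝ) * (2 * rA * (c₁ * ((β + (β₁ + ct * β)) * (1 - (β + (β₁ + ct * β)) * (R * cr) * cr)⁻¹) + c₀ * ((1 - θA * cr)⁻¹ * βQ * cr)))) + (β + (β₁ + ct * β)) * (1 - (β + (β₁ + ct * β)) * (R * cr) * cr)⁻¹ * ((ℓ * (Real.exp 1 * ε)⁻¹ + 2 * ω) * RN) * cr)) + θF) + εF) * cr)⁻¹ * ((Nov * ((((((Fintype.card J : ℝ) * (3 * (((β + (β₁ + ct * β)) * (1 - (β + (β₁ + ct * β)) * (R * cr) * cr)⁻¹) * o₂ + mX * c₂) + 2 * (((1 - θA * cr)⁻¹ * βQ * cr) * o₁ + ((1 - θA * cr)⁻¹ * (1 * mQ + oχ * βQ) * cr + (1 - θA * cr)⁻¹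 * (r𝒲 * ((1 - θA * cr)⁻¹ * βQ * cr) * cr) * cr) * c₁)) + 0) + ((β + (β₁ + ct * β)) * (1 - (β + (β₁ + ct * β)) * (R * cr) * cr)⁻¹) * rN * cr + mX * cN * cr + ((Fintype.card J : ℝ) * (2 * (rA * (c₁ * mX + o₁ * ((β + (β₁ + ct * β)) * (1 - (β + (β₁ + ct * β)) * (R * cr) * cr)⁻¹) + c₀ * ((1 - θA * cr)⁻¹ * (1 * mQ + oχ * βQ) * cr + (1 - θA * cr)⁻¹ * (r𝒲 * ((1 - θA * cr)⁻¹ * βQ * cr) * cr) * cr) + o₀ * ((1 - θA * cr)⁻¹ * βQ * cr)) + oAt * (c₁ * ((β + (β₁ + ct * β)) * (1 - (β + (β₁ + ct * β)) * (R * cr) * cr)⁻¹) + c₀ * ((1 - θA * cr)⁻¹ * βQ * cr)))) + ((β + (β₁ + ct * β)) * (1 - (β + (β₁ + ct * β)) * (R * cr) * cr)⁻¹) * (((ℓ * (Real.exp 1 * ε)⁻¹ + 2 * ω) * rV + 2 * o * RN)) * cr + mX * ((ℓ * (Real.exp 1 * ε)⁻¹ + 2 * ω) * RN) * cr))) + rFK)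 + o * (((((Fintype.card J : ℝ) * (3 * ((β + (β₁ + ct * β)) * (1 - (β + (β₁ + ct * β)) * (R * cr) * cr)⁻¹ * c₂) + 2 * (((1 - θA * cr)⁻¹ * βQ * cr) * c₁)) + 0) + (β + (β₁ + ct * β)) * (1 - (β + (β₁ + ct * β)) * (R * cr) * cr)⁻¹ * cN * cr) + (((Fintype.card J : ℝ) * (2 * rA * (c₁ * ((β + (β₁ + ct * β)) * (1 - (β + (β₁ + ct * β)) * (R * cr) * cr)⁻¹) + c₀ * ((1 - θA * cr)⁻¹ * βQ * cr)))) + (β + (β₁ + ct * β)) * (1 - (β + (β₁ + ct * β)) * (R * cr) * cr)⁻¹ * ((ℓ * (Real.exp 1 * ε)⁻¹ + 2 * ω) * RN) * cr)) + θF) + (1 * rFE + o * εF))) * ((1 - Nov * ((((((Fintype.card J : ℝ) * (3 * ((β + (β₁ + ct * β)) * (1 - (β + (β₁ + ct * β)) * (R * cr) * cr)⁻¹ * c₂) + 2 * (((1 - θA * cr)⁻¹ * βQ * cr) * c₁)) + 0) + (β + (β₁ + ct * β)) * (1 - (β + (β₁ + ct * β)) * (R * cr) * cr)⁻¹ * cN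 * cr) + (((Fintype.card J : ℝ) * (2 * rA * (c₁ * ((β + (β₁ + ct * β)) * (1 - (β + (β₁ + ct * β)) * (R * cr) * cr)⁻¹) + c₀ * ((1 - θA * cr)⁻¹ * βQ * cr)))) + (β + (β₁ + ct * β)) * (1 - (β + (β₁ + ct * β)) * (R * cr) * cr)⁻¹ * ((ℓ * (Real.exp 1 * ε)⁻¹ + 2 * ω) * RN) * cr)) + θF) + εF) * cr)⁻¹ * (Nov * (((1 - θA * cr)⁻¹ * βQ * cr) * 1 + ((β + (β₁ + ct * β)) * (1 - (β + (β₁ + ct * β)) * (R * cr) * cr)⁻¹) * c₁)) * cr) * cr) * cr) *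
        Real.exp (-((ρ₃ - 2 * σ) * g.dist y y')))) := by
  have hβb : 0 ≤ β + (β₁ + ct * β) := by positivity
  have hB : 0 ≤ ((β + (β₁ + ct * β)) * (1 - (β + (β₁ + ct * β)) * (R * cr) * cr)⁻¹) := mul_nonneg hβb (inv_nonneg.2 (by linarith))
  have hinv : 0 ≤ (1 - θA * cr)⁻¹ := inv_nonneg.2 (by linarith)
  have hBX : 0 ≤ ((1 - θA * cr)⁻¹ * βQ * cr) := mul_nonneg (mul_nonneg hinv hβQ) hcr
  have hmF : 0 ≤ 1 * mQ + oχ * βQ := by positivity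
  have hmTX : 0 ≤ ((1 - θA * cr)⁻¹ * (1 * mQ + oχ * βQ) * cr + (1 - θA * cr)⁻¹ * (r𝒲 * ((1 - θA * cr)⁻¹ * βQ * cr) * cr) * cr) :=
    add_nonneg (mul_nonneg (mul_nonneg hinv hmF) hcr) (mul_nonneg (mul_nonneg hinv (mul_nonneg (mul_nonneg hr𝒲 hBX) hcr)) hcr)
  obtain ⟨hΘ, hΘD, -, -, -⟩ := adjCapstoneTwoGrid_letters_nonneg (J := J) hβQ hcr hc₀ hc₁ hc₂ ho₀ ho₁ ho₂ ho (le_refl (0 : ℝ)) hcN hrN hrA hoAt hRN hrV hℓ hω hmX hmQ hr𝒲 hoχ (le_refl (0 : ℝ)) zero_le_one (le_refl (0 : ℝ)) (le_refl (0 : ℝ))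
    (le_refl (0 : ℝ)) (le_refl (0 : ℝ)) (le_refl (0 : ℝ)) hoχc hB hinv hε
  have h2σ : 2 * σ ≤ δW := by linarith
  have rate : ∀ (T : Set g.Site) {c ρ' : ℝ}, 0 ≤ c → ρ₃ ≤ ρ' → ∀ y y' : g.Site,
      ind T y * ind T y' * (c * Real.exp (-(ρ' * g.dist y y'))) ≤ ind T y * ind T y' * (c * Real.exp (-(ρ₃ * g.dist y y'))) :=
    fun T c ρ' hc hρ y y' => mul_le_mul_of_nonneg_left (exp_rate_mono hd hc hρ y y') (mul_nonneg (ind_nonneg _ _) (ind_nonneg _ _))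
  -- one grid (coarse): units, rows, the sandwiched right entry through the shifted partition function, the adjoint remainder row — as FILE 168
  have hGf := fun q => hasMaj_smoothCut_flat blk (S := Sk q) hβ hβ₁ hct (hχt q) (hsub q) (hcut q)
  have hDf := fun q => hasMaj_jet_smoothCut_flat blk τ n (S := Sk q) hβ hβ₁ hct (hχt q) (hdχt q) (hdχtb q) (hs q) (hsb q) (hdd q) (hddb q) (hcut q) (hcutF q) (hcutB q)
  have hunit := fun q => (hasMaj_dressedV_pair blk htri hd hrow hσ hβb hR hcr hσρ hρ₁V hρ₁G hρ₂ hρ₂₁ (hGf q) (hDf q) (hV q) hq).1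
  have hunitW := fun q => isUnit_neumannR (liftBlk blk ι) hd hrow hθA (by linarith) (hW𝒲 q) hqA
  have hDj : ∀ q, ∀ j, (fun j => Sum.elim (fun μ => fgrad n (liftEquiv (τ μ) ι)) (fun μ => bgrad n (liftEquiv (τ μ) ι)) j ∘ₗ (mulOp (fun p : X × ι => (χtX q) p.1) ∘ₗ (N q))) j = (fun j => Sum.elim (fun μ => fgrad n (liftEquiv (τ μ) ι)) (fun μ => bgrad n (liftEquiv (τ μ) ι)) j) j ∘ₗ (mulOp (fun p : X × ι => (χtX q) p.1) ∘ₗ (N q)) := fun _ _ => rfl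
  have hXr : ∀ q, HasMaj (BlockNorm.ofBlocks g (liftBlk blk ι)) (BlockNorm.ofBlocks g (liftBlk blk ι)) (projO none ∘ₗ bgPropV (stack (mulOp (fun p : X × ι => (χtX q) p.1) ∘ₗ (N q)) (fun j => Sum.elim (fun μ => fgrad n (liftEquiv (τ μ) ι)) (fun μ => bgrad n (liftEquiv (τ μ) ι)) j ∘ₗ (mulOp (fun p : X × ι => (χtX q) p.1) ∘ₗ (N q)))) (unstackM ((C q)) ((A q)) + (NV q) ∘ₗ projO (none : Option (J ⊕ J)))) (fun y y' => ind (Sk q) y * ind (Sk q) y' * (((β + (β₁ + ct * β)) * (1 - (β + (β₁ + ct * β)) * (R * cr) * cr)⁻¹) * Real.exp (-(ρ₃ * g.dist y y')))) := fun q =>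
    (hasMaj_smoothCutDressed_loc₂ blk τ n htri hd hrow hσ hβ hβ₁ hct hR hcr hσρ hρ₁V hρ₁G hρ₂ hρ₂₁ (hSχ q) (hSψ q) (hχt q) (hdχt q) (hdχtb q) (hsub q) (hχ q) (hs q)
      (hsb q) (hdd q) (hddb q) (hNψ q) (hcut q) (hcutF q) (hcutB q) (hV q) hq).mono (rate (Sk q) hB (by linarith))
  have hGc : ∀ q, HasMaj (BlockNorm.ofBlocks g (liftBlk blk ι)) (BlockNorm.ofBlocks g (liftBlk blk ι)) (mulOp (fun p : X × ι => (χX q) p.1) ∘ₗ (projO none ∘ₗ bgPropV (stack (mulOp (fun p : X × ι => (χtX q) p.1) ∘ₗ (N q)) (fun j => Sum.elim (fun μ => fgrad n (liftEquiv (τ μ) ι)) (fun μ => bgrad n (liftEquiv (τ μ) ι)) j ∘ₗ (mulOp (fun p : X × ι => (χtX q) p.1) ∘ₗ (N q)))) (unstackM ((C q)) ((A q)) + (NV q) ∘ₗ projO (none : Option (J ⊕ J))))) (fun y y' => ind (Sk q) y * ind (Sk q) y' * (((β + (β₁ + ct * β)) * (1 - (β + (β₁ + ct * β)) * (R * cr)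 * cr)⁻¹) * Real.exp (-(ρ₃ * g.dist y y')))) := fun q => by
    rw [mulOp_comp_smoothCutDressed τ n (hχ q) (hNψ q) (hunit q)]
    exact hXr q
  have hWχ : ∀ q, mulOp (fun p : X × ι => (χX q) p.1) ∘ₗ ((mulOp (fun p : X × ι => (χtX q) p.1) ∘ₗ (N q)) ∘ₗ (unstackM ((C q)) ((A q)) + (NV q) ∘ₗ projO (none : Option (J ⊕ J))) ∘ₗ
        stack LinearMap.id (fun j => Sum.elim (fun μ => fgrad n (liftEquiv (τ μ) ι)) (fun μ => bgrad n (liftEquiv (τ μ) ι)) j) ∘ₗ mulOp (fun p : X × ι => (χX q) p.1)) = ((mulOp (fun p : X × ι => (χtX q) p.1) ∘ₗ (N q)) ∘ₗ (unstackM ((C q)) ((A q)) + (NV q) ∘ₗ projO (none : Option (J ⊕ J))) ∘ₗ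
        stack LinearMap.id (fun j => Sum.elim (fun μ => fgrad n (liftEquiv (τ μ) ι)) (fun μ => bgrad n (liftEquiv (τ μ) ι)) j) ∘ₗ mulOp (fun p : X × ι => (χX q) p.1)) := fun q => by
    simp only [← LinearMap.comp_assoc]; rw [hχ q]
  have hTX : ∀ q, HasMaj (BlockNorm.ofBlocks g (liftBlk blk ι)) (BlockNorm.ofBlocks g (liftBlk blk ι)) (neumannR ((mulOp (fun p : X × ι => (χtX q) p.1) ∘ₗ (N q)) ∘ₗ (unstackM ((C q)) ((A q)) + (NV q) ∘ₗ projO (none : Option (J ⊕ J))) ∘ₗ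
        stack LinearMap.id (fun j => Sum.elim (fun μ => fgrad n (liftEquiv (τ μ) ι)) (fun μ => bgrad n (liftEquiv (τ μ) ι)) j) ∘ₗ mulOp (fun p : X × ι => (χX q) p.1)) ∘ₗ (mulOp (fun p : X × ι => (χtX q) p.1) ∘ₗ (Tb q) ν)) (fun y y' => ind (Sk q) y * ind (Sk q) y' * (((1 - θA * cr)⁻¹ * βQ * cr) * Real.exp (-(ρ₃ * g.dist y y')))) := fun q =>
    (hasMaj_adjRightEntry_loc₂ blk htri hd hd0 hrow hσ hcr (hSχ q) (hSψ₂ q) (hχt q) (hWχ q) (hχ q) (hTbψ q ν) hβQ hθA h2σ (hW𝒲 q) (hTbr q ν) hqA).mono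
      (rate (Sk q) hBX (by linarith))
  have hT2c : ∀ q, HasMaj (BlockNorm.ofBlocks g (liftBlk blk ι)) (BlockNorm.ofBlocks g (liftBlk blk ι)) (mulOp (fun p : X × ι => (χX q) p.1) ∘ₗ (neumannR ((mulOp (fun p : X × ι => (χtX q) p.1) ∘ₗ (N q)) ∘ₗ (unstackM ((C q)) ((A q)) + (NV q) ∘ₗ projO (none : Option (J ⊕ J))) ∘ₗ
        stack LinearMap.id (fun j => Sum.elim (fun μ => fgrad n (liftEquiv (τ μ) ι)) (fun μ => bgrad n (liftEquiv (τ μ) ι)) j) ∘ₗ mulOp (fun p : X × ι => (χX q) p.1)) ∘ₗ (mulOp (fun p : X × ι => (χtX q) p.1) ∘ₗ (Tb q) ν))) (fun y y' => ind (Sk q) y * ind (Sk q) y' * (((1 - θA * cr)⁻¹ * βQ * cr) * Real.exp (-(ρ₃ * g.dist y y')))) := fun q =>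
    (hasMaj_diag_comp (liftBlk blk ι) (fun _ => zero_le_one) (hasMaj_mulOp (g := g) (liftBlk blk ι) (m := fun _ => (1 : ℝ)) (fun _ => zero_le_one) (fun p : X × ι => hχ1 q p.1))
      (hTX q)).mono fun y y' => le_of_eq (one_mul _)
  have hE2 : ∀ q, mulOp (fun p : X × ι => (χX q) p.1) ∘ₗ (projO none ∘ₗ bgPropV (stack (mulOp (fun p : X × ι => (χtX q) p.1) ∘ₗ (N q)) (fun j => Sum.elim (fun μ => fgrad n (liftEquiv (τ μ) ι)) (fun μ => bgrad n (liftEquiv (τ μ) ι)) j ∘ₗ (mulOp (fun p : X × ι => (χtX q) p.1) ∘ₗ (N q)))) (unstackM ((C q)) ((A q)) + (NV q) ∘ₗ projO (none : Option (J ⊕ J)))) ∘ₗ bgrad n (liftEquiv (τ ν) ι) ∘ₗ mulOp (fun p : X × ι => (hX q) (τ ν p.1)) =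
      (mulOp (fun p : X × ι => (χX q) p.1) ∘ₗ (neumannR ((mulOp (fun p : X × ι => (χtX q) p.1) ∘ₗ (N q)) ∘ₗ (unstackM ((C q)) ((A q)) + (NV q) ∘ₗ projO (none : Option (J ⊕ J))) ∘ₗ
        stack LinearMap.id (fun j => Sum.elim (fun μ => fgrad n (liftEquiv (τ μ) ι)) (fun μ => bgrad n (liftEquiv (τ μ) ι)) j) ∘ₗ mulOp (fun p : X × ι => (χX q) p.1)) ∘ₗ (mulOp (fun p : X × ι => (χtX q) p.1) ∘ₗ (Tb q) ν))) ∘ₗ mulOp (fun p : X × ι => (hX q) (τ ν p.1)) := fun q => by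
    have hsand := smoothCutDressed_comp_grad_sandwich τ n (hDj q) (hunit q) (hχ q) (hunitW q) (Q := bgrad n (liftEquiv (τ ν) ι)) (hTb q ν)
    have ha := comp_mulOp_of_sandwich (a := fun p : X × ι => (hX q) (τ ν p.1)) hsand (fun p hp => hlayν q p.1 hp)
    rw [ha, ← LinearMap.comp_assoc]
  have hleib : ∀ q, mulOp (fun p : X × ι => (hX q) p.1) ∘ₗ bgrad n (liftEquiv (τ ν) ι) =
      bgrad n (liftEquiv (τ ν) ι) ∘ₗ mulOp (fun p : X × ι => (hX q) ((τ ν) p.1)) + mulOp (fun p : X × ι => -(fgrad n (τ ν) (hX q) p.1)) := fun q =>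
    mulOp_fst_comp_bgrad_leib n (τ ν) (hX q)
  -- one grid (fine)
  have hGf' := fun q => hasMaj_smoothCut_flat (blk ∘ π) (S := Sk q) hβ hβ₁ hct (hχt' q) (hsub' q) (hcut' q)
  have hDf' := fun q => hasMaj_jet_smoothCut_flat (blk ∘ π) τ' n' (S := Sk q) hβ hβ₁ hct (hχt' q) (hdχt' q) (hdχtb' q) (hs' q) (hsb' q) (hdd' q) (hddb' q) (hcut' q) (hcutF' q) (hcutB' q)
  have hunit' := fun q => (hasMaj_dressedV_pair (blk ∘ π) htri hd hrow hσ hβb hR hcr hσρ hρ₁V hρ₁G hρ₂ hρ₂₁ (hGf' q) (hDf' q) (hV' q) hq).1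
  have hunitW' := fun q => isUnit_neumannR (liftBlk (blk ∘ π) ι) hd hrow hθA (by linarith) (hW𝒲' q) hqA
  have hDj' : ∀ q, ∀ j, (fun j => Sum.elim (fun μ => fgrad n' (liftEquiv (τ' μ) ι)) (fun μ => bgrad n' (liftEquiv (τ' μ) ι)) j ∘ₗ (mulOp (fun p : X' × ι => (χtX' q) p.1) ∘ₗ (N' q))) j = (fun j => Sum.elim (fun μ => fgrad n' (liftEquiv (τ' μ) ι)) (fun μ => bgrad n' (liftEquiv (τ' μ) ι)) j) j ∘ₗ (mulOp (fun p : X' × ι => (χtX' q) p.1) ∘ₗ (N' q)) := fun _ _ => rfl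
  have hXr' : ∀ q, HasMaj (BlockNorm.ofBlocks g (liftBlk (blk ∘ π) ι)) (BlockNorm.ofBlocks g (liftBlk (blk ∘ π) ι)) (projO none ∘ₗ bgPropV (stack (mulOp (fun p : X' × ι => (χtX' q) p.1) ∘ₗ (N' q)) (fun j => Sum.elim (fun μ => fgrad n' (liftEquiv (τ' μ) ι)) (fun μ => bgrad n' (liftEquiv (τ' μ) ι)) j ∘ₗ (mulOp (fun p : X' × ι => (χtX' q) p.1) ∘ₗ (N' q)))) (unstackM ((C' q)) ((A' q)) + (NV' q) ∘ₗ projO (none : Option (J ⊕ J)))) (fun y y' => ind (Sk q) y * ind (Sk q) y' * (((β + (β₁ + ct * β)) * (1 - (β + (β₁ + ct * β)) * (R * cr) * cr)⁻¹) * Real.exp (-(ρ₃ * g.dist y y')))) := fun q =>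
    (hasMaj_smoothCutDressed_loc₂ (blk ∘ π) τ' n' htri hd hrow hσ hβ hβ₁ hct hR hcr hσρ hρ₁V hρ₁G hρ₂ hρ₂₁ (hSχ' q) (hSψ' q) (hχt' q) (hdχt' q) (hdχtb' q) (hsub' q) (hχ' q) (hs' q)
      (hsb' q) (hdd' q) (hddb' q) (hNψ' q) (hcut' q) (hcutF' q) (hcutB' q) (hV' q) hq).mono (rate (Sk q) hB (by linarith))
  have hGc' : ∀ q, HasMaj (BlockNorm.ofBlocks g (liftBlk (blk ∘ π) ι)) (BlockNorm.ofBlocks g (liftBlk (blk ∘ π) ι)) (mulOp (fun p : X' × ι => (χX' q) p.1) ∘ₗ (projO none ∘ₗ bgPropV (stack (mulOp (fun p : X' × ι => (χtX' q) p.1) ∘ₗ (N' q)) (fun j => Sum.elim (fun μ => fgrad n' (liftEquiv (τ' μ) ι)) (fun μ => bgrad n' (liftEquiv (τ' μ) ι)) j ∘ₗ (mulOp (fun p : X' × ι => (χtX' q) p.1) ∘ₗ (N' q)))) (unstackM ((C' q)) ((A' q)) + (NV' q) ∘ₗ projO (none : Option (J ⊕ J))))) (fun y y' => ind (Sk q)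 y * ind (Sk q) y' * (((β + (β₁ + ct * β)) * (1 - (β + (β₁ + ct * β)) * (R * cr) * cr)⁻¹) * Real.exp (-(ρ₃ * g.dist y y')))) := fun q => by
    rw [mulOp_comp_smoothCutDressed τ' n' (hχ' q) (hNψ' q) (hunit' q)]
    exact hXr' q
  have hWχ' : ∀ q, mulOp (fun p : X' × ι => (χX' q) p.1) ∘ₗ ((mulOp (fun p : X' × ι => (χtX' q) p.1) ∘ₗ (N' q)) ∘ₗ (unstackM ((C' q)) ((A' q)) + (NV' q) ∘ₗ projO (none : Option (J ⊕ J))) ∘ₗ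
        stack LinearMap.id (fun j => Sum.elim (fun μ => fgrad n' (liftEquiv (τ' μ) ι)) (fun μ => bgrad n' (liftEquiv (τ' μ) ι)) j) ∘ₗ mulOp (fun p : X' × ι => (χX' q) p.1)) = ((mulOp (fun p : X' × ι => (χtX' q) p.1) ∘ₗ (N' q)) ∘ₗ (unstackM ((C' q)) ((A' q)) + (NV' q) ∘ₗ projO (none : Option (J ⊕ J))) ∘ₗ
        stack LinearMap.id (fun j => Sum.elim (fun μ => fgrad n' (liftEquiv (τ' μ) ι)) (fun μ => bgrad n' (liftEquiv (τ' μ) ι)) j) ∘ₗ mulOp (fun p : X' × ι => (χX' q) p.1)) := fun q => by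
    simp only [← LinearMap.comp_assoc]; rw [hχ' q]
  have hTX' : ∀ q, HasMaj (BlockNorm.ofBlocks g (liftBlk (blk ∘ π) ι)) (BlockNorm.ofBlocks g (liftBlk (blk ∘ π) ι)) (neumannR ((mulOp (fun p : X' × ι => (χtX' q) p.1) ∘ₗ (N' q)) ∘ₗ (unstackM ((C' q)) ((A' q)) + (NV' q) ∘ₗ projO (none : Option (J ⊕ J))) ∘ₗ
        stack LinearMap.id (fun j => Sum.elim (fun μ => fgrad n' (liftEquiv (τ' μ) ι)) (fun μ => bgrad n' (liftEquiv (τ' μ) ι)) j) ∘ₗ mulOp (fun p : X' × ι => (χX' q) p.1)) ∘ₗ (mulOp (fun p : X' × ι => (χtX' q) p.1) ∘ₗ (Tb' q) ν)) (fun y y' => ind (Sk q) y * ind (Sk q) y' * (((1 - θA * cr)⁻¹ * βQ * cr) * Real.exp (-(ρ₃ * g.dist y y')))) := fun q =>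
    (hasMaj_adjRightEntry_loc₂ (blk ∘ π) htri hd hd0 hrow hσ hcr (hSχ' q) (hSψ₂' q) (hχt' q) (hWχ' q) (hχ' q) (hTbψ' q ν) hβQ hθA h2σ (hW𝒲' q) (hTbr' q ν) hqA).mono
      (rate (Sk q) hBX (by linarith))
  have hT2c' : ∀ q, HasMaj (BlockNorm.ofBlocks g (liftBlk (blk ∘ π) ι)) (BlockNorm.ofBlocks g (liftBlk (blk ∘ π) ι)) (mulOp (fun p : X' × ι => (χX' q) p.1) ∘ₗ (neumannR ((mulOp (fun p : X' × ι => (χtX' q) p.1) ∘ₗ (N' q)) ∘ₗ (unstackM ((C' q)) ((A' q)) + (NV' q) ∘ₗ projO (none : Option (J ⊕ J))) ∘ₗ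
        stack LinearMap.id (fun j => Sum.elim (fun μ => fgrad n' (liftEquiv (τ' μ) ι)) (fun μ => bgrad n' (liftEquiv (τ' μ) ι)) j) ∘ₗ mulOp (fun p : X' × ι => (χX' q) p.1)) ∘ₗ (mulOp (fun p : X' × ι => (χtX' q) p.1) ∘ₗ (Tb' q) ν))) (fun y y' => ind (Sk q) y * ind (Sk q) y' * (((1 - θA * cr)⁻¹ * βQ * cr) * Real.exp (-(ρ₃ * g.dist y y')))) := fun q =>
    (hasMaj_diag_comp (liftBlk (blk ∘ π) ι) (fun _ => zero_le_one) (hasMaj_mulOp (g := g) (liftBlk (blk ∘ π) ι) (m := fun _ => (1 : ℝ)) (fun _ => zero_le_one) (fun p : X' × ι => hχ1' q p.1))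
      (hTX' q)).mono fun y y' => le_of_eq (one_mul _)
  have hE2' : ∀ q, mulOp (fun p : X' × ι => (χX' q) p.1) ∘ₗ (projO none ∘ₗ bgPropV (stack (mulOp (fun p : X' × ι => (χtX' q) p.1) ∘ₗ (N' q)) (fun j => Sum.elim (fun μ => fgrad n' (liftEquiv (τ' μ) ι)) (fun μ => bgrad n' (liftEquiv (τ' μ) ι)) j ∘ₗ (mulOp (fun p : X' × ι => (χtX' q) p.1) ∘ₗ (N' q)))) (unstackM ((C' q)) ((A' q)) + (NV' q) ∘ₗ projO (none : Option (J ⊕ J)))) ∘ₗ bgrad n' (liftEquiv (τ' ν) ι) ∘ₗ mulOp (fun p : X' × ι => (hX' q) (τ' ν p.1)) =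
      (mulOp (fun p : X' × ι => (χX' q) p.1) ∘ₗ (neumannR ((mulOp (fun p : X' × ι => (χtX' q) p.1) ∘ₗ (N' q)) ∘ₗ (unstackM ((C' q)) ((A' q)) + (NV' q) ∘ₗ projO (none : Option (J ⊕ J))) ∘ₗ
        stack LinearMap.id (fun j => Sum.elim (fun μ => fgrad n' (liftEquiv (τ' μ) ι)) (fun μ => bgrad n' (liftEquiv (τ' μ) ι)) j) ∘ₗ mulOp (fun p : X' × ι => (χX' q) p.1)) ∘ₗ (mulOp (fun p : X' × ι => (χtX' q) p.1) ∘ₗ (Tb' q) ν))) ∘ₗ mulOp (fun p : X' × ι => (hX' q) (τ' ν p.1)) := fun q => by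
    have hsand := smoothCutDressed_comp_grad_sandwich τ' n' (hDj' q) (hunit' q) (hχ' q) (hunitW' q) (Q := bgrad n' (liftEquiv (τ' ν) ι)) (hTb' q ν)
    have ha := comp_mulOp_of_sandwich (a := fun p : X' × ι => (hX' q) (τ' ν p.1)) hsand (fun p hp => hlayν' q p.1 hp)
    rw [ha, ← LinearMap.comp_assoc]
  have hleib' : ∀ q, mulOp (fun p : X' × ι => (hX' q) p.1) ∘ₗ bgrad n' (liftEquiv (τ' ν) ι) =
      bgrad n' (liftEquiv (τ' ν) ι) ∘ₗ mulOp (fun p : X' × ι => (hX' q) ((τ' ν) p.1)) + mulOp (fun p : X' × ι => -(fgrad n' (τ' ν) (hX' q) p.1)) := fun q =>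
    mulOp_fst_comp_bgrad_leib n' (τ' ν) (hX' q)
  -- the adjoint remainder rows against the GLOBAL operators (FILE 167 ★), both grids
  have hK := hasMaj_smoothCutDressed_comp_commOp_global blk τ n htri hd hsymm hd0 hrow hσ hβ hβ₁ hβQ hct hR hcr hc₀ hc₁ hc₂ hcN hrA hRN hℓ hω hθA hε hσρ hρ₁V hρ₁G hρ₂ hρ₂₁ hρ₃ hρ₃N hρ₃V hρ₃₂ hρ₂W hSχ hSψ hSψ₂ hχt hdχt hdχtb hsub hχ hs hsb hdd hddb hNψ hcut hcutF hcutB hTf hTb hTfr hTbr hTfψ hTbψ hV hq hW𝒲 hqA hh1 hh1b hh0 hLip hrh hh2 (fun k μ p => by simpa only [Function.comp_apply, Equiv.symm_apply_apply] using hh2f k μ (liftEquiv (τ μ) ι p)) hh2b hlayf hlayb hA hKN hNV hcov hFK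
  have hK' := hasMaj_smoothCutDressed_comp_commOp_global (blk ∘ π) τ' n' htri hd hsymm hd0 hrow hσ hβ hβ₁ hβQ hct hR hcr hc₀ hc₁ hc₂ hcN hrA hRN hℓ hω hθA hε hσρ hρ₁V hρ₁G hρ₂ hρ₂₁ hρ₃ hρ₃N hρ₃V hρ₃₂ hρ₂W hSχ' hSψ' hSψ₂' hχt' hdχt' hdχtb' hsub' hχ' hs' hsb' hdd' hddb' hNψ' hcut' hcutF' hcutB' hTf' hTb' hTfr' hTbr' hTfψ' hTbψ' hV' hq hW𝒲' hqA hh1' hh1b' hh0' hLip hrh' hh2' hh2f' hh2b' hlayf' hlayb' hA' hKN' hNV' hcov' hFK'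
  -- two grids, per cube: the cut rows' defect (by letter), the sandwiched entries' defect, the adjoint remainder rows' defect (FILE 156 ★★★ + the far defect)
  have hDX : ∀ q, HasMaj (BlockNorm.ofBlocks g (liftBlk blk ι)) (BlockNorm.ofBlocks g (liftBlk (blk ∘ π) ι)) (idef (pull (liftMap π ι)) (pull (liftMap π ι)) (projO none ∘ₗ bgPropV (stack (mulOp (fun p : X' × ι => (χtX' q) p.1) ∘ₗ (N' q)) (fun j => Sum.elim (fun μ => fgrad n' (liftEquiv (τ' μ) ι)) (fun μ => bgrad n' (liftEquiv (τ' μ) ι)) j ∘ₗ (mulOp (fun p : X' × ι => (χtX' q) p.1) ∘ₗ (N' q)))) (unstackM ((C' q)) ((A' q)) + (NV' q) ∘ₗ projO (none : Option (J ⊕ J)))) (projO none ∘ₗ bgPropV (stack (mulOp (fun p : X × ι => (χtX q) p.1) ∘ₗ (N q)) (fun j => Sum.elim (fun μ => fgrad n (liftEquiv (τ μ) ι)) (fun μ => bgrad n (liftEquiv (τ μ) ι)) j ∘ₗ (mulOp (fun p : X × ι => (χtX q) p.1) ∘ₗ (N q)))) (unstackM ((C q)) ((A q)) + (NV q) ∘ₗ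 projO (none : Option (J ⊕ J))))) (fun y y' => ind (Sk q) y * ind (Sk q) y' * (mX * Real.exp (-(ρ₃ * g.dist y y')))) := fun q => (hDG0 q).mono (rate (Sk q) hmX (by linarith))
  have hIGc : ∀ q, HasMaj (BlockNorm.ofBlocks g (liftBlk blk ι)) (BlockNorm.ofBlocks g (liftBlk (blk ∘ π) ι)) (idef (pull (liftMap π ι)) (pull (liftMap π ι)) (mulOp (fun p : X' × ι => (χX' q) p.1) ∘ₗ (projO none ∘ₗ bgPropV (stack (mulOp (fun p : X' × ι => (χtX' q) p.1) ∘ₗ (N' q)) (fun j => Sum.elim (fun μ => fgrad n' (liftEquiv (τ' μ) ι)) (fun μ => bgrad n' (liftEquiv (τ' μ) ι)) j ∘ₗ (mulOp (fun p : X' × ι => (χtX' q) p.1) ∘ₗ (N' q)))) (unstackM ((C' q)) ((A' q)) + (NV' q) ∘ₗ projO (none : Option (J ⊕ J))))) (mulOp (fun p : X × ι => (χX q) p.1) ∘ₗ (projO none ∘ₗ bgPropV (stack (mulOp (fun p : X × ι => (χtX q) p.1) ∘ₗ (N q)) (fun j => Sum.elim (fun μ => fgrad n (liftEquiv (τ μ)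 ι)) (fun μ => bgrad n (liftEquiv (τ μ) ι)) j ∘ₗ (mulOp (fun p : X × ι => (χtX q) p.1) ∘ₗ (N q)))) (unstackM ((C q)) ((A q)) + (NV q) ∘ₗ projO (none : Option (J ⊕ J)))))) (fun y y' => ind (Sk q) y * ind (Sk q) y' * (mX * Real.exp (-(ρ₃ * g.dist y y')))) := fun q => by
    rw [mulOp_comp_smoothCutDressed τ n (hχ q) (hNψ q) (hunit q), mulOp_comp_smoothCutDressed τ' n' (hχ' q) (hNψ' q) (hunit' q)]
    exact hDX q
  have hFχ : ∀ q (T : (X × ι → ℝ) →ₗ[ℝ] (X × ι → ℝ)), mulOp (fun p : X × ι => (χX q) p.1) ∘ₗ (mulOp (fun p : X × ι => (χtX q) p.1) ∘ₗ T) = mulOp (fun p : X × ι => (χtX q) p.1) ∘ₗ T := fun q T => by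
    rw [← LinearMap.comp_assoc, hχ q]
  have hFχ' : ∀ q (T : (X' × ι → ℝ) →ₗ[ℝ] (X' × ι → ℝ)), mulOp (fun p : X' × ι => (χX' q) p.1) ∘ₗ (mulOp (fun p : X' × ι => (χtX' q) p.1) ∘ₗ T) = mulOp (fun p : X' × ι => (χtX' q) p.1) ∘ₗ T := fun q T => by
    rw [← LinearMap.comp_assoc, hχ' q]
  have hFψ : ∀ q (T : (X × ι → ℝ) →ₗ[ℝ] (X × ι → ℝ)), T ∘ₗ mulOp (fun p : X × ι => (ψ₂X q) p.1) = T →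
      (mulOp (fun p : X × ι => (χtX q) p.1) ∘ₗ T) ∘ₗ mulOp (fun p : X × ι => (ψ₂X q) p.1) = mulOp (fun p : X × ι => (χtX q) p.1) ∘ₗ T := fun q T h => by rw [LinearMap.comp_assoc, h]
  have hFψ' : ∀ q (T : (X' × ι → ℝ) →ₗ[ℝ] (X' × ι → ℝ)), T ∘ₗ mulOp (fun p : X' × ι => (ψ₂X' q) p.1) = T →
      (mulOp (fun p : X' × ι => (χtX' q) p.1) ∘ₗ T) ∘ₗ mulOp (fun p : X' × ι => (ψ₂X' q) p.1) = mulOp (fun p : X' × ι => (χtX' q) p.1) ∘ₗ T := fun q T h => by rw [LinearMap.comp_assoc, h]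
  have hFr : ∀ q (T : (X × ι → ℝ) →ₗ[ℝ] (X × ι → ℝ)), HasMaj (BlockNorm.ofBlocks g (liftBlk blk ι)) (BlockNorm.ofBlocks g (liftBlk blk ι)) T (fun y y' => ind (Sk q) y * ind (Sk q) y' * (βQ * Real.exp (-(δW * g.dist y y')))) →
      HasMaj (BlockNorm.ofBlocks g (liftBlk blk ι)) (BlockNorm.ofBlocks g (liftBlk blk ι)) (mulOp (fun p : X × ι => (χtX q) p.1) ∘ₗ T) (fun y y' => βQ * Real.exp (-(δW * g.dist y y'))) := fun q T hT =>
    (hasMaj_diag_comp (liftBlk blk ι) (fun _ => zero_le_one) (hasMaj_mulOp (g := g) (liftBlk blk ι) (m := fun _ => (1 : ℝ)) (fun _ => zero_le_one) (fun p : X × ι => hχt q p.1))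
      (hT.mono fun y y' => loc₂_le_plain hβQ y y')).mono fun y y' => le_of_eq (one_mul _)
  have hDF : ∀ q (T : (X × ι → ℝ) →ₗ[ℝ] (X × ι → ℝ)) (T' : (X' × ι → ℝ) →ₗ[ℝ] (X' × ι → ℝ)),
      HasMaj (BlockNorm.ofBlocks g (liftBlk blk ι)) (BlockNorm.ofBlocks g (liftBlk blk ι)) T (fun y y' => ind (Sk q) y * ind (Sk q) y' * (βQ * Real.exp (-(δW * g.dist y y')))) →
      HasMaj (BlockNorm.ofBlocks g (liftBlk blk ι)) (BlockNorm.ofBlocks g (liftBlk (blk ∘ π) ι)) (idef (pull (liftMap π ι)) (pull (liftMap π ι)) T' T) (fun y y' => mQ * Real.exp (-(δW * g.dist y y'))) →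
      HasMaj (BlockNorm.ofBlocks g (liftBlk blk ι)) (BlockNorm.ofBlocks g (liftBlk (blk ∘ π) ι)) (idef (pull (liftMap π ι)) (pull (liftMap π ι)) (mulOp (fun p : X' × ι => (χtX' q) p.1) ∘ₗ T') (mulOp (fun p : X × ι => (χtX q) p.1) ∘ₗ T)) (fun y y' => (1 * mQ + oχ * βQ) * Real.exp (-(δW * g.dist y y'))) :=
    fun q T T' hT hD => hasMaj_idef_mulOp_comp_plain blk π zero_le_one hoχ (hχt' q) (hfitχ q) (hT.mono fun y y' => loc₂_le_plain hβQ y y') hD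
  have hDTX : ∀ q, HasMaj (BlockNorm.ofBlocks g (liftBlk blk ι)) (BlockNorm.ofBlocks g (liftBlk (blk ∘ π) ι)) (idef (pull (liftMap π ι)) (pull (liftMap π ι)) (neumannR ((mulOp (fun p : X' × ι => (χtX' q) p.1) ∘ₗ (N' q)) ∘ₗ (unstackM ((C' q)) ((A' q)) + (NV' q) ∘ₗ projO (none : Option (J ⊕ J))) ∘ₗ
        stack LinearMap.id (fun j => Sum.elim (fun μ => fgrad n' (liftEquiv (τ' μ) ι)) (fun μ => bgrad n' (liftEquiv (τ' μ) ι)) j) ∘ₗ mulOp (fun p : X' × ι => (χX' q) p.1)) ∘ₗ (mulOp (fun p : X' × ι => (χtX' q) p.1) ∘ₗ (Tb' q) ν)) (neumannR ((mulOp (fun p : X × ι => (χtX q) p.1) ∘ₗ (N q)) ∘ₗ (unstackM ((C q)) ((A q)) + (NV q) ∘ₗ projO (none : Option (J ⊕ J))) ∘ₗ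
        stack LinearMap.id (fun j => Sum.elim (fun μ => fgrad n (liftEquiv (τ μ) ι)) (fun μ => bgrad n (liftEquiv (τ μ) ι)) j) ∘ₗ mulOp (fun p : X × ι => (χX q) p.1)) ∘ₗ (mulOp (fun p : X × ι => (χtX q) p.1) ∘ₗ (Tb q) ν))) (fun y y' => ind (Sk q) y * ind (Sk q) y' * (((1 - θA * cr)⁻¹ * (1 * mQ + oχ * βQ) * cr + (1 - θA * cr)⁻¹ * (r𝒲 * ((1 - θA * cr)⁻¹ * βQ * cr) * cr) * cr) * Real.exp (-(ρ₃ * g.dist y y')))) := fun q =>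
    (hasMaj_idef_neumannR_comp_loc₂ blk π htri hd hd0 hrow hσ hcr (hSχ q) (hSψ₂ q) (hSχ' q) (hSψ₂' q) (hWχ q) (hFχ q ((Tb q) ν)) (hFψ q _ (hTbψ q ν)) (hWχ' q) (hFχ' q ((Tb' q) ν))
      (hFψ' q _ (hTbψ' q ν)) hβQ hθA hmF hr𝒲 h2σ (hW𝒲 q) (hW𝒲' q) (hD𝒲 q) (hFr q _ (hTbr q ν)) (hDF q _ _ (hTbr q ν) (hDTb q ν)) hqA).mono (rate (Sk q) hmTX (by linarith))
  have hIT2 : ∀ q, HasMaj (BlockNorm.ofBlocks g (liftBlk blk ι)) (BlockNorm.ofBlocks g (liftBlk (blk ∘ π) ι)) (idef (pull (liftMap π ι)) (pull (liftMap π ι)) (mulOp (fun p : X' × ι => (χX' q) p.1) ∘ₗ (neumannR ((mulOp (fun p : X' × ι => (χtX' q) p.1) ∘ₗ (N' q)) ∘ₗ (unstackM ((C' q)) ((A' q)) + (NV' q) ∘ₗ projO (none : Option (J ⊕ J))) ∘ₗ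
        stack LinearMap.id (fun j => Sum.elim (fun μ => fgrad n' (liftEquiv (τ' μ) ι)) (fun μ => bgrad n' (liftEquiv (τ' μ) ι)) j) ∘ₗ mulOp (fun p : X' × ι => (χX' q) p.1)) ∘ₗ (mulOp (fun p : X' × ι => (χtX' q) p.1) ∘ₗ (Tb' q) ν))) (mulOp (fun p : X × ι => (χX q) p.1) ∘ₗ (neumannR ((mulOp (fun p : X × ι => (χtX q) p.1) ∘ₗ (N q)) ∘ₗ (unstackM ((C q)) ((A q)) + (NV q) ∘ₗ projO (none : Option (J ⊕ J))) ∘ₗ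
        stack LinearMap.id (fun j => Sum.elim (fun μ => fgrad n (liftEquiv (τ μ) ι)) (fun μ => bgrad n (liftEquiv (τ μ) ι)) j) ∘ₗ mulOp (fun p : X × ι => (χX q) p.1)) ∘ₗ (mulOp (fun p : X × ι => (χtX q) p.1) ∘ₗ (Tb q) ν)))) (fun y y' => ind (Sk q) y * ind (Sk q) y' * ((1 * ((1 - θA * cr)⁻¹ * (1 * mQ + oχ * βQ) * cr + (1 - θA * cr)⁻¹ * (r𝒲 * ((1 - θA * cr)⁻¹ * βQ * cr) * cr) * cr) + oχc * ((1 - θA * cr)⁻¹ * βQ * cr)) * Real.exp (-(ρ₃ * g.dist y y')))) := fun q => by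
    rw [idef_comp (pull (liftMap π ι)) (pull (liftMap π ι)) (pull (liftMap π ι)) (mulOp (fun p : X' × ι => (χX' q) p.1)) (neumannR ((mulOp (fun p : X' × ι => (χtX' q) p.1) ∘ₗ (N' q)) ∘ₗ (unstackM ((C' q)) ((A' q)) + (NV' q) ∘ₗ projO (none : Option (J ⊕ J))) ∘ₗ
        stack LinearMap.id (fun j => Sum.elim (fun μ => fgrad n' (liftEquiv (τ' μ) ι)) (fun μ => bgrad n' (liftEquiv (τ' μ) ι)) j) ∘ₗ mulOp (fun p : X' × ι => (χX' q) p.1)) ∘ₗ (mulOp (fun p : X' × ι => (χtX' q) p.1) ∘ₗ (Tb' q) ν)) (mulOp (fun p : X × ι => (χX q) p.1)) (neumannR ((mulOp (fun p : X × ι => (χtX q) p.1) ∘ₗ (N q)) ∘ₗ (unstackM ((C q)) ((A q)) + (NV q) ∘ₗ projO (none : Option (J ⊕ J))) ∘ₗ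
        stack LinearMap.id (fun j => Sum.elim (fun μ => fgrad n (liftEquiv (τ μ) ι)) (fun μ => bgrad n (liftEquiv (τ μ) ι)) j) ∘ₗ mulOp (fun p : X × ι => (χX q) p.1)) ∘ₗ (mulOp (fun p : X × ι => (χtX q) p.1) ∘ₗ (Tb q) ν))]
    have t1 := hasMaj_mulOp_comp_loc₂' (liftBlk blk ι) (liftMap π ι) zero_le_one (fun p' : X' × ι => hχ1' q p'.1) (hDTX q)
    have t2 := hasMaj_idef_mulOp_comp_loc₂ (liftBlk blk ι) (liftMap π ι) (a' := fun p : X' × ι => (χX' q) p.1) (a := fun p : X × ι => (χX q) p.1) hoχc (fun p' : X' × ι => hfitχc q p'.1) (hTX q)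
    refine (t1.add t2).mono fun y y' => le_of_eq ?_
    ring
  have hDW : ∀ q, HasMaj (BlockNorm.ofBlocks g (liftBlk blk ι)) (BlockNorm.ofBlocks g (liftBlk (blk ∘ π) ι))
      (idef (pull (liftMap π ι)) (pull (liftMap π ι)) ((projO none ∘ₗ bgPropV (stack (mulOp (fun p : X' × ι => (χtX' q) p.1) ∘ₗ (N' q)) (fun j => Sum.elim (fun μ => fgrad n' (liftEquiv (τ' μ) ι)) (fun μ => bgrad n' (liftEquiv (τ' μ) ι)) j ∘ₗ (mulOp (fun p : X' × ι => (χtX' q) p.1) ∘ₗ (N' q)))) (unstackM ((C' q)) ((A' q)) + (NV' q) ∘ₗ projO (none : Option (J ⊕ J)))) ∘ₗ commOp (0 : (X' × ι → ℝ) →ₗ[ℝ] (X' × ι → ℝ)) (fun p : X' × ι => (hX' q) p.1)) ((projO none ∘ₗ bgPropV (stack (mulOp (fun p : X × ι => (χtX q) p.1) ∘ₗ (N q)) (fun j => Sum.elim (fun μ => fgrad n (liftEquiv (τ μ) ι)) (fun μ => bgrad n (liftEquiv (τ μ) ι)) j ∘ₗ (mulOp (fun p : X × ι => (χtX q) p.1)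 ∘ₗ (N q)))) (unstackM ((C q)) ((A q)) + (NV q) ∘ₗ projO (none : Option (J ⊕ J)))) ∘ₗ commOp (0 : (X × ι → ℝ) →ₗ[ℝ] (X × ι → ℝ)) (fun p : X × ι => (hX q) p.1)))
      (fun y y' => ind (Sk q) y * ind (Sk q) y' * (0 * Real.exp (-(ρ₂ * g.dist y y')))) := fun q => by
    rw [show commOp (0 : (X × ι → ℝ) →ₗ[ℝ] (X × ι → ℝ)) (fun p : X × ι => (hX q) p.1) = 0 from by simp [commOp],
      show commOp (0 : (X' × ι → ℝ) →ₗ[ℝ] (X' × ι → ℝ)) (fun p : X' × ι => (hX' q) p.1) = 0 from by simp [commOp], LinearMap.comp_zero, LinearMap.comp_zero, idef_zero]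
    exact (hasMaj_zero _ _).mono fun y y' => le_of_eq (by ring)
  have hDK : ∀ q, HasMaj (BlockNorm.ofBlocks g (liftBlk blk ι)) (BlockNorm.ofBlocks g (liftBlk (blk ∘ π) ι)) (idef (pull (liftMap π ι)) (pull (liftMap π ι)) ((projO none ∘ₗ bgPropV (stack (mulOp (fun p : X' × ι => (χtX' q) p.1) ∘ₗ (N' q)) (fun j => Sum.elim (fun μ => fgrad n' (liftEquiv (τ' μ) ι)) (fun μ => bgrad n' (liftEquiv (τ' μ) ι)) j ∘ₗ (mulOp (fun p : X' × ι => (χtX' q) p.1) ∘ₗ (N' q)))) (unstackM ((C' q)) ((A' q)) + (NV' q) ∘ₗ projO (none : Option (J ⊕ J)))) ∘ₗ commOp Δ' (fun p : X' × ι => (hX' q) p.1)) ((projO none ∘ₗ bgPropV (stack (mulOp (fun p : X × ι => (χtX q) p.1) ∘ₗ (N q)) (fun j => Sum.elim (fun μ => fgrad n (liftEquiv (τ μ) ι)) (fun μ => bgrad n (liftEquiv (τ μ) ι)) j ∘ₗ (mulOp (fun p : X × ι => (χtX q) p.1) ∘ₗ (N q)))) (unstackM ((C q)) ((A q)) + (NV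 q) ∘ₗ projO (none : Option (J ⊕ J)))) ∘ₗ commOp Δ (fun p : X × ι => (hX q) p.1))) (fun y y' => ind (Sk q) y * (((((((Fintype.card J : ℝ) * (3 * (((β + (β₁ + ct * β)) * (1 - (β + (β₁ + ct * β)) * (R * cr) * cr)⁻¹) * o₂ + mX * c₂) + 2 * (((1 - θA * cr)⁻¹ * βQ * cr) * o₁ + ((1 - θA * cr)⁻¹ * (1 * mQ + oχ * βQ) * cr + (1 - θA * cr)⁻¹ * (r𝒲 * ((1 - θA * cr)⁻¹ * βQ * cr) * cr) * cr) * c₁)) + 0) + ((β + (β₁ + ct * β)) * (1 - (β + (β₁ + ct * β)) * (R * cr) * cr)⁻¹) * rN * cr + mX * cN * cr + ((Fintype.card J : ℝ) * (2 * (rA * (c₁ * mX + o₁ * ((β + (β₁ + ct * β)) * (1 - (β + (β₁ + ct * β)) * (R * cr) * cr)⁻¹) + c₀ * ((1 - θA * cr)⁻¹ * (1 * mQ + oχ * βQ) * cr + (1 - θA * cr)⁻¹ * (r𝒲 * ((1 - θA * cr)⁻¹ * βQ * cr) * cr) * cr) + o₀ * ((1 - θA * cr)⁻¹ * βQ * cr))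 + oAt * (c₁ * ((β + (β₁ + ct * β)) * (1 - (β + (β₁ + ct * β)) * (R * cr) * cr)⁻¹) + c₀ * ((1 - θA * cr)⁻¹ * βQ * cr)))) + ((β + (β₁ + ct * β)) * (1 - (β + (β₁ + ct * β)) * (R * cr) * cr)⁻¹) * (((ℓ * (Real.exp 1 * ε)⁻¹ + 2 * ω) * rV + 2 * o * RN)) * cr + mX * ((ℓ * (Real.exp 1 * ε)⁻¹ + 2 * ω) * RN) * cr)))) + rFK) * Real.exp (-(ρ₃ * g.dist y y')))) := fun q => by
    rw [hcov q, hcov' q, commOp_add_left, commOp_add_left, LinearMap.comp_add, LinearMap.comp_add, idef_add]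
    have h156 := hasMaj_idef_smoothCutDressed_comp_commOp_cubeOp_out_of_sandwich blk π τ τ' n n' (C q) (C' q) (A q) (A' q) (hX q) (hX' q) htri hd hsymm hd0 hrow hσ hβ hβ₁ hβQ hct hR hcr hc₀ hc₁ hc₂
      ho₀ ho₁ ho₂ ho (le_refl (0 : ℝ)) hcN hrN hrA hoAt hRN hrV hℓ hω hθA hmX hmQ hr𝒲 hoχ hε hσρ hρ₁V hρ₁G hρ₂ hρ₂₁ hρ₃ hρ₃N hρ₃V hρ₃₂ hρ₂W
      (hSχ q) (hSψ₂ q) (hχt q) (hdχt q) (hdχtb q) (hsub q) (hχ q) (hs q) (hsb q) (hdd q) (hddb q) (hSχ' q) (hSψ' q) (hSψ₂' q) (hχt' q) (hdχt' q) (hdχtb' q) (hsub' q) (hχ' q) (hs' q) (hsb' q) (hdd' q) (hddb' q) (hNψ' q) (hfitχ q) (hcut q) (hcutF q) (hcutB q) (hcut' q) (hcutF' q) (hcutB' q) (hTf q) (hTb q) (hTf' q) (hTb' q) (hTfr q) (hTbr q) (hTfr' q) (hTbr' q) (hTfψ q) (hTbψ q) (hTfψ' q) (hTbψ' q) (hDTf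 q) (hDTb q) (hV q) (hV' q) hq (hW𝒲 q) (hW𝒲' q) hqA (hD𝒲 q) (hDG0 q) (hhD q) (hhB q) (hh2 q) (hh2f q) (hh2b q) (hfD q) (hfB q) (hf2 q) (hf2f q) (hf2b q) (hh1 q) (hh1b q) (hh0 q) (hh1' q) (hh1b' q) (hh0' q) (hf1 q) (hf1b q) (hf0 q) (hf0b q) (hfit q) (hLip q) (hrh q) (hrh' q) (hlayf q) (hlayb q) (hlayf' q) (hlayb' q) (hA q) (hfAb q) (hfAf q) (hDW q) (hKN q) (hDKN q) (hNV q) (hNV' q) (hDNV q)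
    exact (h156.add (hDFK q)).mono fun y y' => le_of_eq (by ring)
  -- FILE 158 ★★★: the η-defect of entry 2 of the adjoint glued operators with the true defects; FILE 167 ★★: they ARE the right inverses `Y`, `Y′`
  have hΘF : 0 ≤ (((((Fintype.card J : ℝ) * (3 * ((β + (β₁ + ct * β)) * (1 - (β + (β₁ + ct * β)) * (R * cr) * cr)⁻¹ * c₂) + 2 * (((1 - θA * cr)⁻¹ * βQ * cr) * c₁)) + 0) + (β + (β₁ + ct * β)) * (1 - (β + (β₁ + ct * β)) * (R * cr) * cr)⁻¹ * cN * cr) + (((Fintype.card J : ℝ) * (2 * rA * (c₁ * ((β + (β₁ + ct * β)) * (1 - (β + (β₁ + ct * β)) * (R * cr) * cr)⁻¹) + c₀ * ((1 - θA * cr)⁻¹ * βQ * cr)))) + (β + (β₁ + ct * β)) * (1 - (β + (β₁ + ct * β)) * (R * cr) * cr)⁻¹ * ((ℓ * (Real.exp 1 * ε)⁻¹ + 2 * ω) * RN) * cr)) + θF) := add_nonneg hΘ hθF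
  have hm2 : 0 ≤ (1 * ((1 - θA * cr)⁻¹ * (1 * mQ + oχ * βQ) * cr + (1 - θA * cr)⁻¹ * (r𝒲 * ((1 - θA * cr)⁻¹ * βQ * cr) * cr) * cr) + oχc * ((1 - θA * cr)⁻¹ * βQ * cr)) := add_nonneg (mul_nonneg zero_le_one hmTX) (mul_nonneg hoχc hBX)
  have hrD : 0 ≤ (((((Fintype.card J : ℝ) * (3 * (((β + (β₁ + ct * β)) * (1 - (β + (β₁ + ct * β)) * (R * cr) * cr)⁻¹) * o₂ + mX * c₂) + 2 * (((1 - θA * cr)⁻¹ * βQ * cr) * o₁ + ((1 - θA * cr)⁻¹ * (1 * mQ + oχ * βQ) * cr + (1 - θA * cr)⁻¹ * (r𝒲 * ((1 - θA * cr)⁻¹ * βQ * cr) * cr) * cr) * c₁)) + 0) + ((β + (β₁ + ct * β)) * (1 - (β + (β₁ + ct * β)) * (R * cr) * cr)⁻¹) * rN * cr + mX * cN * cr + ((Fintype.card J : ℝ) * (2 * (rA * (c₁ * mX + o₁ * ((β + (β₁ + ct * β)) * (1 - (β + (β₁ + ct * β)) * (R * cr) * cr)⁻¹) + c₀ * ((1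 - θA * cr)⁻¹ * (1 * mQ + oχ * βQ) * cr + (1 - θA * cr)⁻¹ * (r𝒲 * ((1 - θA * cr)⁻¹ * βQ * cr) * cr) * cr) + o₀ * ((1 - θA * cr)⁻¹ * βQ * cr)) + oAt * (c₁ * ((β + (β₁ + ct * β)) * (1 - (β + (β₁ + ct * β)) * (R * cr) * cr)⁻¹) + c₀ * ((1 - θA * cr)⁻¹ * βQ * cr)))) + ((β + (β₁ + ct * β)) * (1 - (β + (β₁ + ct * β)) * (R * cr) * cr)⁻¹) * (((ℓ * (Real.exp 1 * ε)⁻¹ + 2 * ω) * rV + 2 * o * RN)) * cr + mX * ((ℓ * (Real.exp 1 * ε)⁻¹ + 2 * ω) * RN) * cr))) + rFK) := add_nonneg hΘD hrFK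
  have hZ := hasMaj_idef_glueInvL_parametrix_comp_cut_of_defect_out (liftBlk blk ι) (liftMap π ι) Sk htri hd hd0 hrow hσ hcr
    (E := bgrad n (liftEquiv (τ ν) ι)) (E' := bgrad n' (liftEquiv (τ' ν) ι)) (h := fun q => fun p : X × ι => (hX q) p.1) (h' := fun q => fun p : X' × ι => (hX' q) p.1)
    (hs := fun q => fun p : X × ι => (hX q) (τ ν p.1)) (hs' := fun q => fun p : X' × ι => (hX' q) (τ' ν p.1))
    (dh := fun q => fun p : X × ι => -(fgrad n (τ ν) (hX q) p.1)) (dh' := fun q => fun p : X' × ι => -(fgrad n' (τ' ν) (hX' q) p.1))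
    (χ := fun q => fun p : X × ι => (χX q) p.1) (χ' := fun q => fun p : X' × ι => (χX' q) p.1)
    (G := fun q => (projO none ∘ₗ bgPropV (stack (mulOp (fun p : X × ι => (χtX q) p.1) ∘ₗ (N q)) (fun j => Sum.elim (fun μ => fgrad n (liftEquiv (τ μ) ι)) (fun μ => bgrad n (liftEquiv (τ μ) ι)) j ∘ₗ (mulOp (fun p : X × ι => (χtX q) p.1) ∘ₗ (N q)))) (unstackM ((C q)) ((A q)) + (NV q) ∘ₗ projO (none : Option (J ⊕ J))))) (G' := fun q => (projO none ∘ₗ bgPropV (stack (mulOp (fun p : X' × ι => (χtX' q) p.1) ∘ₗ (N' q)) (fun j => Sum.elim (fun μ => fgrad n' (liftEquiv (τ' μ) ι)) (fun μ => bgrad n' (liftEquiv (τ' μ) ι)) j ∘ₗ (mulOp (fun p : X' × ι => (χtX' q) p.1) ∘ₗ (N' q)))) (unstackM ((C' q)) ((A' q)) + (NV' q) ∘ₗ projO (none : Option (J ⊕ J)))))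
    (T₂ := fun q => mulOp (fun p : X × ι => (χX q) p.1) ∘ₗ (neumannR ((mulOp (fun p : X × ι => (χtX q) p.1) ∘ₗ (N q)) ∘ₗ (unstackM ((C q)) ((A q)) + (NV q) ∘ₗ projO (none : Option (J ⊕ J))) ∘ₗ
        stack LinearMap.id (fun j => Sum.elim (fun μ => fgrad n (liftEquiv (τ μ) ι)) (fun μ => bgrad n (liftEquiv (τ μ) ι)) j) ∘ₗ mulOp (fun p : X × ι => (χX q) p.1)) ∘ₗ (mulOp (fun p : X × ι => (χtX q) p.1) ∘ₗ (Tb q) ν)))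
    (T₂' := fun q => mulOp (fun p : X' × ι => (χX' q) p.1) ∘ₗ (neumannR ((mulOp (fun p : X' × ι => (χtX' q) p.1) ∘ₗ (N' q)) ∘ₗ (unstackM ((C' q)) ((A' q)) + (NV' q) ∘ₗ projO (none : Option (J ⊕ J))) ∘ₗ
        stack LinearMap.id (fun j => Sum.elim (fun μ => fgrad n' (liftEquiv (τ' μ) ι)) (fun μ => bgrad n' (liftEquiv (τ' μ) ι)) j) ∘ₗ mulOp (fun p : X' × ι => (χX' q) p.1)) ∘ₗ (mulOp (fun p : X' × ι => (χtX' q) p.1) ∘ₗ (Tb' q) ν))) (Ed := Ed) (Ed' := Ed')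
    hB hBX zero_le_one hc₁ ho hos ho₁ hmX hm2 hΘF hεF hrD hrFE hNov hσρ₃ hleib hleib' hhcut hhcut' hE2 hE2' (fun q p => hhabs q p.1) (fun q p => hhabs' q p.1)
    (fun q p => hhabs q (τ ν p.1)) (fun q p => by rw [abs_neg]; exact hh1 q ν p.1) (fun q p => hfit q p.1) (fun q p => hfits q p.1)
    (fun q p => by rw [neg_sub_neg, abs_sub_comm]; exact hf1 q ν p.1) hN hGc hGc' hT2c hT2c' hIGc hIT2 hK hK' hDK hEd hEd' hDEd hqL
  rw [glued_adjoint_eq_rightInverse blk τ n htri hd hsymm hd0 hrow hσ hβ hβ₁ hβQ hct hR hcr hc₀ hc₁ hc₂ hcN hrA hRN hℓ hω hθA hθF hεF hNov hε hσρ hρ₁V hρ₁G hρ₂ hρ₂₁ hρ₃ hρ₃N hρ₃V hρ₃₂ hρ₂W hσρ₃ hSχ hSψ hSψ₂ hχt hdχt hdχtb hsub hχ hs hsb hdd hddb hNψ hcut hcutF hcutB hTf hTb hTfr hTbr hTfψ hTbψ hV hq hW𝒲 hqA hhabs hh1 hh1b hh0 hLip hrh hh2 (fun k μ p => by simpa only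 [Function.comp_apply, Equiv.symm_apply_apply] using hh2f k μ (liftEquiv (τ μ) ι p)) hh2b hlayf hlayb h236 hA hKN hNV hN hcov hFK hloc hEd hqL hY,
    glued_adjoint_eq_rightInverse (blk ∘ π) τ' n' htri hd hsymm hd0 hrow hσ hβ hβ₁ hβQ hct hR hcr hc₀ hc₁ hc₂ hcN hrA hRN hℓ hω hθA hθF hεF hNov hε hσρ hρ₁V hρ₁G hρ₂ hρ₂₁ hρ₃ hρ₃N hρ₃V hρ₃₂ hρ₂W hσρ₃ hSχ' hSψ' hSψ₂' hχt' hdχt' hdχtb' hsub' hχ' hs' hsb' hdd' hddb' hNψ' hcut' hcutF' hcutB' hTf' hTb' hTfr' hTbr' hTfψ' hTbψ' hV' hq hW𝒲' hqA hhabs' hh1' hh1b' hh0' hLip hrh' hh2' hh2f' hh2b' hlayf' hlayb' h236' hA' hKN' hNV' hN hcov' hFK' hloc' hEd' hqL hY'] at hZ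
  exact hZ

end Summit.QuantumFields.YangMills.BalabanUVNodes.N15.Gluing

end
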